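import Summits.SmoothPoincare4.SmoothPoincare4.Theses.EntropyRung
import Summits.SmoothPoincare4.SmoothPoincare4.Theses.WeylBudget
import Literature.Geometry.Riemannian.ChangGurskyYangProofs
import Literature.Geometry.Riemannian.ChangGurskyYangEuler
import Literature.Geometry.Riemannian.HamiltonCurvatureODE
import Literature.Geometry.Riemannian.PuncturedShrinkingSphereFour
import Literature.Geometry.Riemannian.WeylEnergyScaling
import Literature.Geometry.Riemannian.QuotientMetric
import Literature.Geometry.Riemannian.ConstantCurvatureDescent
import Literature.Geometry.Lorentzian.WeylConformal
import Literature.Geometry.Lorentzian.ChartWeyl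
import Literature.Topology.FourManifolds.RealProjectiveSpaceProofs
import Literature.Topology.FourManifolds.SphereSimplyConnected

/-!
# Disproof of `ChangGurskyYang` — findings (cdisprove gen 1 v1–v3; gen 2 v4, 2026-08-16)

Crux `EntropyRung.ChangGurskyYang` (item stmt-SmoothPoincare4-10834; also `WeylBudget` rank 9): for
every compact simply connected Hausdorff second-countable `C^∞` `4`-manifold `M` (charts into `ℝ⁴`),
IF `M` carries a `C^∞` Riemannian metric `g` with Levi-Civita connection, `scal_g > 0` everywhere
and Weyl energy `∫_M |W_g|² dV_g < 32π²` (`(0,4)`-norm), THEN `M ≅ S⁴` (`C^∞` diffeomorphism).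
It is VERBATIM the named fact `Literature.Geometry.Riemannian.changGurskyYang_sphere_four`
(`crux_iff_fact`, `Iff.rfl`) = Chang–Gursky–Yang 2003, Thm. A, simply connected `scal > 0` case.

FINDINGS (everything below is kernel-checked unless marked PAPER):

* §0 `crux_iff_fact` — the crux IS the tree's named fact (a published theorem). No refutation is
  possible short of an error in print; the standing adversary can only (i) audit the vocabulary for
  junk, (ii) decompose, (iii) prove the hypotheses load-bearing, (iv) record which strengthenings die.
* §1 STRUCTURE `crux_iff_split`: `ChangGurskyYang ↔ OnHomotopySpheres ∧ WeylObstructionOffSpheres`,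
  and `spc4_implies_onHomotopySpheres : SPC4 → OnHomotopySpheres`. So the crux is the conjunction of
  (a) an SPC4-IMPLIED fragment (homotopy 4-spheres with a light psc metric are standard) and
  (b) a pure OBSTRUCTION (no closed simply connected `M ≄ₕ S⁴` carries a psc metric with
  `∫|W|² < 32π²`), which is PAPER-true independently of CGY: `b₂(M) ≥ 1`, Hodge gives a harmonic
  self-dual (or anti-self-dual) 2-form, and Gursky 1998 (Ann. Math. 148, Thm. 1: `Y > 0`, `b₂⁺ > 0`
  ⇒ `∫|W⁺|²_End ≥ (4π²/3)(2χ+3τ)`) yields `∫|W|²_(0,4) ≥ 48π² > 32π²` in every case; `b₂ = 0` ⇒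
  `M ≃ₕ S⁴` (Milnor–Whitehead). Hence ANY refutation of the crux either disproves SPC4 or contradicts
  Gursky 1998 / CGY 2003. BOTH consumers (WeylBudget `closes`, CompactShrinkerGap line
  cgy-variance-pivot STUB 6) apply the crux only at `M ≃ₕ S⁴`, i.e. they need `OnHomotopySpheres`
  alone — kernel-checked for WeylBudget: `spc4_of_weylLight_of_onHomotopySpheres` (its `closes` with
  the crux replaced by the fragment); for EntropyRung the consumer `CompactShrinkerGap` carries
  `M ≃ₕ S⁴` in its binder. Planner information: the item could be weakened to that fragment at no
  cost to either route (it would then be FORMALLY SPC4-implied, i.e. unrefutable, like its consumers).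
* §2 NON-VACUITY `hyps_round`, `crux_at_sphereFour`: the round `S⁴` satisfies the antecedent
  (`R = 12`, `∫|W|² = 0`; tree theorem `roundSphere_four_changGurskyYang_hypotheses`) and the
  consequent (refl), so the crux is true outright at `M = S⁴`.
* §3 LOAD-BEARING HYPOTHESES (each `…Without<H>` is the crux with `H` dropped/weakened):
  - `changGurskyYang_false_without_compact` — `[CompactSpace M]` is load-bearing: the punctured round
    sphere `(ℝ⁴, 96(|y|²+4)⁻²δ)` (tree `PuncturedShrinkingSphereFour.punctP`) is smooth, Riemannian,
    `R = 2 > 0`, `|W|² ≡ 0` (conformal covariance `|W_{ψ²δ}|² = ψ⁻⁴|W_δ|² = 0`, proved here: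
    `flatW_weylNormSq`, `punctP_weylEnergy`), simply connected (`ℝ⁴` contractible), and `ℝ⁴ ≇ S⁴`
    (non-compact). LANDED: `Theorems/ChangGurskyYang/Negative/WithoutCompactFalse.lean` (p73668,
    commit 53a24f129e61) — importable by ideators/planners.
  - `changGurskyYang_false_without_simplyConnected` — `[SimplyConnectedSpace M]` is load-bearing even
    when weakened to `[ConnectedSpace M]`: the round `ℝℙ⁴ = S⁴/±1` (tree `RealProjectiveSpace 4`,
    quotient metric `rpMetric` of `roundMetric` by the antipodal isometry, proved here:
    `roundMetric_antipodal`, `comap_rpMetric`) has constant curvature `1` (descent,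
    `hasConstantSectionalCurvature_rpMetric`), `R = 12`, `∫|W|² = 0`, and `ℝℙ⁴ ≇ S⁴`
    (`π₁(ℝℙ⁴) = ℤ₂`, `IsRealProjectiveSpace.not_simplyConnectedSpace` vs `simplyConnectedSpace_euclideanSphere`).
    This is CGY's own second alternative "or `ℝP⁴`" (and `S³×S¹`, `W = 0`, `χ = 0`, is the other
    equality case of their Thm. B). LANDED: `Theorems/ChangGurskyYang/Negative/WithoutSimplyConnectedFalse.lean`
    (p73993, reviewed, commit 24699e70c912; def-free twin of this section at `M = S⁴/±1`) — importable.
  - `ChangGurskyYangWithoutScalarPos` (drop `R > 0`): PAPER-OPEN, no kill available. A counterexample is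
    a closed simply connected `M ≄ S⁴` with a metric of `∫|W|²_(0,4) < 32π²` and no sign on `R`.
    Signature forces `∫|W|² ≥ ∫|W^±|² ≥ 48π²|τ|` for ALL metrics (Hirzebruch), so `τ(M) = 0`
    (`S²×S²`, `#k S²×S²`, `ℂP²#ℂP²bar`, …); there the infimum of the (conformally invariant) Weyl
    functional over metrics of NEGATIVE Yamabe class is not known — Gursky's bound needs `Y ≥ 0`
    (Weitzenböck on `Λ⁺`), and Seiberg–Witten bounds (LeBrun) vanish on `S²×S²`. Restricted to homotopy
    spheres it is again SPC4-implied. Recorded for ideators: "is `inf_g ∫|W_g|²` on `S²×S²` zero?".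
  - `ChangGurskyYangWithoutRiemannian` (drop `g.IsRiemannian`): JUNK-false on PAPER — `weylEnergy` is
    DEFINED as `0` for non-Riemannian `g` (`weylEnergy_of_not_isRiemannian`), so any closed simply
    connected `M ≄ S⁴` with an indefinite metric of positive "scalar curvature" kills it, e.g. the
    neutral product `(S²(1) × S²(2), g₁ ⊕ (−g₂))`, `R = 2 − ½ > 0`; not Lean-constructible today (no
    product-manifold metric modelled on `𝓡 4` in the tree). Information only: the conjunct is needed.
  - `ChangGurskyYangWithoutWeylBound` (drop `∫|W|² < 32π²`, i.e. "psc ⇒ S⁴"): PAPER-false —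
    `(ℂP², g_FS)` (`R = 24`), `S²×S²` (product) are closed simply connected psc and `≄ₕ S⁴` (`b₂ ≠ 0`).
    The tree has `ComplexProjectiveSpace 2` as a manifold on `𝓡 (2·2)` with its (co)homology, and the
    Fubini–Study FORM (`Kaehler/FubiniStudyProjectiveSpace.lean`), but no FS METRIC with curvature and
    no product metric on `𝓡 4`: kernel witness pending a Kähler-metric layer. Obviously load-bearing.
  - `∃ _ : g.HasLeviCivita`: NOT a loophole and NOT a burden — it is a THEOREM for every smooth metric
    (`PseudoRiemannianMetric.hasLeviCivita`, used throughout §3), `hasLeviCivita_of_smooth`.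
* §4 STRENGTHENINGS. `ChangGurskyYangBelow c` (threshold `32π²` replaced by `c`): follows from the crux
  for `c ≤ 32π²` (`below_of_le`); PAPER-false for `c > 48π²` by `(ℂP², g_FS)`: `R = 24 > 0`,
  `∫|W|²_(0,4) = 96 · π²/2 = 48π² = 16π²χ(ℂP²)` (CGY 2003, Thm. B, p. 106: "Theorem A is sharp … the
  case of equality: conformal to `ℂP²` with `g_FS`, or isometrically covered by `S³×S¹`" — page-read
  this session, arXiv:math/0309287 p. 2; arithmetic `fubiniStudy_weylEnergy_arith`); for `32π² < c ≤ 48π²` it is the crux plus an SPC4-type statement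
  about homotopy spheres with `∫|W|² ∈ [32π², c)` — no cheap kill. Product `S²(a)×S²(b)`:
  `∫|W|²_(0,4) = (64π²/3)(a²+b²)²/(a²b²) ≥ 256π²/3 > 64π² = 16π²χ` (`product_weylEnergy_ge`): the
  cheapest explicit simply connected competitor misses CGY's bar by a factor `4/3` and the typed bar
  `32π²` by `8/3` — consistent, no refutation from products.
* §5 JUNK PROBES (all closed by tree theorems): scaling `g ↦ c·g` cannot shrink the energy
  (`hyps_constSmul`: the antecedent is scale-invariant — `weylEnergy_constSmul_four`,
  `scalarCurvature_constSmul`); `weylNormSq` is a `⨆` over orthonormal frames but the sup is ATTAINED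
  (`weylNormSq_eq_weylNormSqFrame_four`); `weylEnergy < ⊤` on closed manifolds (`weylEnergy_lt_top`), so
  `< 32π²` is a condition on a real number; the `(0,4)`-norm convention and the constant `32π² = 16π²χ(S⁴)`
  are calibrated on `ℂP²` (sharp) and `S²×S²` (§4). The conclusion's notation
  `M ≃ₘ⟮𝓡 4, 𝓡 4⟯ Metric.sphere 0 1` parses with `N = Metric.sphere 0 1` (checked: `crux_at_sphereFour`).
* §6 BINDER HYGIENE (gen 2, kernel): `crux_iff_withoutSecondCountable` — `[SecondCountableTopology M]`
  follows from compact + charted on `ℝ⁴`, so it is NOT load-bearing (the crux with it dropped is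
  EQUIVALENT to the crux); `crux_iff_noLCBinder` — the `∃ _ : g.HasLeviCivita` binder is cosmetic
  (a `Prop`; every instance is `g.hasLeviCivita`). Remaining binders: `T2Space` is needed to even
  TYPE `weylEnergy`; `Compact`, `SimplyConnected` are load-bearing (§3a–b); `IsManifold … ∞` types
  the Levi-Civita API. Gen-2 re-audit of the vocabulary (own reading): `≃ₘ⟮𝓡 4, 𝓡 4⟯` is `C^∞`
  (`Diffeomorph … ∞`, not `ω`); `riemannianMeasure` is Euclidean-normalised with the chart formula
  `dV = √det g dx` PROVED (`riemannianMeasure_eq_integral_sqrt_det_holds`), so the bar `32π²` is not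
  shifted by a measure constant; CGY Remark 2 / (0.4) / Margerin's `WP` page-read (arXiv:math/0309287
  pp. 1–4): `(0,4)`-norms throughout, `8π²χ = ∫(¼|W|² - ½|E|² + R²/24)`, sharp at `ℂP²`, `S³×S¹`.
* §7 PRE-EMPTIVE TARGETS (gen 2): the three LEAVES `hMargerin` / `hCGB` / `hThm14` of the tree's
  kernel-checked reduction `changGurskyYang_sphere_four_of_margerin_of_chernGaussBonnet_of_thm14`
  (= the stubs every round-1 idea card discharges), audited AS TYPED: `MargerinLeaf` TRUE in print
  (the strict `WP < 1/6` is load-bearing: `MargerinLeafNonStrict` is PAPER-false by `S³×S¹`, `ℂP²`,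
  CGY p. 106); `CGBLeaf` TRUE; **`Thm14Leaf` (= `hThm14` VERBATIM) is PAPER-FALSE AS TYPED — its
  binder lacks `[ConnectedSpace M]`; witness `S⁴_round ⊔ (S³×S¹)_prod`** (`Y > 0`,
  `¼∫|W|² = 0 < 16π² = ∫σ₂`, but `∫σ₂(A_g) dV_g = 0` for EVERY conformal `g` on the `S³×S¹`
  component, so no pointwise `σ₂(A_g) > ¼|W_g|²`). REPAIR kernel-checked: the reduction needs
  Thm. 1.4 only for CONNECTED `M` (`Thm14LeafConnected`), indeed only in the ideators' `scal > 0`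
  shape `Thm14LeafPsc` (= card gv-continuity-path's `thm14_gurskyViaclovsky` verbatim):
  `crux_of_leaves_connected`, `crux_of_leaves_psc`, and `Thm14Leaf → Thm14LeafConnected → Thm14LeafPsc`.
  MESSAGE TO THE LEAD: never register `hThm14` verbatim as a stub; use `Thm14LeafConnected` /
  `Thm14LeafPsc`. The near-miss `thm14Leaf_false` is this file's only `sorry` (obstruction: no
  disjoint-union metric, no `S³×S¹` metric, no conformal invariance of `∫σ₂` in the tree).
* §8 (gen 2, PAPER): `0 < scal` may be weakened to `0 ≤ scal` (`ChangGurskyYangScalarNonneg`: true by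
  CGB — `R ≡ 0 ⇒ ∫|W|² = 32π²χ + 2∫|E|² ≥ 64π²` — else the class is Yamabe-positive) and `< 32π²` to
  `≤ 32π²` (`ChangGurskyYangEnergyLe`: CGY Thm. B) — neither STRICTNESS is load-bearing; the psc
  CLASS and the energy BOUND are (§3c–d).
* §9 TARGETS, PRE-EMPTIVE (gen 2, kernel): the ideators' published FIRST LEMMAS as typed.
  **`Sketch3.MargerinPolynomialNonpos` / `MargerinPolynomialNeg` (card margerin-certified-cone) are
  FALSE AS TYPED** — quantified over ALL block triples, they omit the symmetry of `A`, `C`; integer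
  witness `A = !![2,0,1; 1,1,-1; -1,1,1]`, `B = 0`, `C = 1` gives fundamental polynomial `+1120`
  (`Sketch3AsTyped.margerinPolynomialNonpos_false`, `…Neg_false`, on verbatim copies of the defs;
  def-free twin LANDING as `Theorems/ChangGurskyYang/Negative/MargerinPolynomialAsTypedFalse.lean`).
  Repair = restrict to `A = Aᵀ`, `C = Cᵀ`, `tr A = tr C`, i.e. ideator 2's `margerinP2_nonpos`, which
  an independent adversarial search (`kit/p2_search.py`, kit j010242–j010244) did NOT break: max
  `P₂ = 0` only on the rigid rays `S³×ℝ`, `ℂP²`; the `k = 7/10` control does break, as it must.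
  The remaining first lemmas (`WeylShiftedGV` = `Thm14LeafPsc`, `ShiftedPathStart`, `RoundLimit`,
  `weakPinching_ge_on_neck`) are true in print.

WHY IT RESISTS: it is a published theorem (CGY 2003 Thm. A via Thm. 1.4 + Chern–Gauss–Bonnet +
Margerin 1998; the tree proves the reduction `changGurskyYang_sphere_four_of_margerin_of_chernGaussBonnet_of_thm14`),
faithfully vendored (audited by grounder g18-7 and refuters g43-10/g44-47; re-audited symbol by
symbol by gen 1 and gen 2), doubly protected off homotopy spheres by Gursky 1998, and SPC4-implied on
them. Targets (lead's stuck stubs): none registered yet (`payload.targets = []`); §7 and §9 stand in.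
-/

noncomputable section

namespace Summit.SmoothPoincare4.SmoothPoincare4.Cruxes.ChangGurskyYang.Disproof

set_option linter.dupNamespace false

open scoped Manifold ContDiff Topology RealInnerProductSpace ContinuousMap
open Literature.Geometry.Lorentzian Literature.Geometry.Lorentzian.PseudoRiemannianMetric
open Literature.Geometry.Riemannian Literature.Topology.FourManifolds
open Summit.SmoothPoincare4.SmoothPoincare4.Theses.EntropyRung (ChangGurskyYang)
open Metric Module Function

/-! ## §0 Dictionary -/

/-- Local notation: the standard `S⁴ ⊂ ℝ⁵` of the crux's conclusion. -/
local notation "S⁴" => (Metric.sphere (0 : EuclideanSpace ℝ (Fin 5)) 1)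

/-- The ANTECEDENT of the crux at a manifold `M`: a `C^∞` Riemannian metric with Levi-Civita
connection, positive scalar curvature and Weyl energy `< 32π²`. [cite: ChangGurskyYang2003, Thm. A] -/
def Hyps (M : Type) [TopologicalSpace M] [T2Space M] [ChartedSpace (EuclideanSpace ℝ (Fin 4)) M]
    [IsManifold (𝓡 4) ∞ M] : Prop :=
  ∃ g : PseudoRiemannianMetric (𝓡 4) ∞ (EuclideanSpace ℝ (Fin 4)) (TangentSpace (𝓡 4) : M → Type _),
    ∃ _ : g.HasLeviCivita, g.IsRiemannian ∧ (∀ x, 0 < g.scalarCurvature x) ∧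
      g.weylEnergy < ENNReal.ofReal (32 * Real.pi ^ 2)

/-- The crux is VERBATIM the tree's named fact `changGurskyYang_sphere_four` (CGY 2003, Thm. A,
simply connected `scal > 0` case). [cite: ChangGurskyYang2003, Thm. A] -/
theorem crux_iff_fact : ChangGurskyYang ↔ changGurskyYang_sphere_four := Iff.rfl

/-- The crux, read through `Hyps`. [cite: ChangGurskyYang2003, Thm. A] -/
theorem crux_iff_hyps : ChangGurskyYang ↔
    ∀ (M : Type) [TopologicalSpace M] [T2Space M] [SecondCountableTopology M]
      [ChartedSpace (EuclideanSpace ℝ (Fin 4)) M] [IsManifold (𝓡 4) ∞ M] [CompactSpace M]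
      [SimplyConnectedSpace M], Hyps M → Nonempty (M ≃ₘ⟮𝓡 4, 𝓡 4⟯ S⁴) :=
  Iff.rfl

/-- The `∃ _ : g.HasLeviCivita` binder is free: every smooth metric on a `4`-manifold has its
Levi-Civita connection in the tree's sense (`PseudoRiemannianMetric.hasLeviCivita`). [folklore] -/
theorem hasLeviCivita_of_smooth {M : Type} [TopologicalSpace M]
    [ChartedSpace (EuclideanSpace ℝ (Fin 4)) M] [IsManifold (𝓡 4) ∞ M]
    (g : PseudoRiemannianMetric (𝓡 4) ∞ (EuclideanSpace ℝ (Fin 4)) (TangentSpace (𝓡 4) : M → Type _)) :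
    g.HasLeviCivita :=
  g.hasLeviCivita

/-! ## §1 Structure: SPC4-fragment ∧ obstruction-fragment -/

/-- The crux RESTRICTED to homotopy 4-spheres (the only case either consumer route uses).
[cite: ChangGurskyYang2003, Thm. A] -/
def OnHomotopySpheres : Prop :=
  ∀ (M : Type) [TopologicalSpace M] [T2Space M] [SecondCountableTopology M]
    [ChartedSpace (EuclideanSpace ℝ (Fin 4)) M] [IsManifold (𝓡 4) ∞ M] [CompactSpace M]
    [SimplyConnectedSpace M], M ≃ₕ S⁴ → Hyps M → Nonempty (M ≃ₘ⟮𝓡 4, 𝓡 4⟯ S⁴)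

/-- The OBSTRUCTION half: a closed simply connected `4`-manifold NOT homotopy equivalent to `S⁴`
carries no psc metric of Weyl energy `< 32π²` (PAPER: Gursky 1998 Thm. 1 + Hodge + `b₂ = 0 ⇒ ≃ₕ S⁴`).
[cite: Gursky1998, Thm. 1] -/
def WeylObstructionOffSpheres : Prop :=
  ∀ (M : Type) [TopologicalSpace M] [T2Space M] [SecondCountableTopology M]
    [ChartedSpace (EuclideanSpace ℝ (Fin 4)) M] [IsManifold (𝓡 4) ∞ M] [CompactSpace M]
    [SimplyConnectedSpace M], IsEmpty (M ≃ₕ S⁴) → ¬ Hyps M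

/-- **The crux splits** as (SPC4-type recognition on homotopy spheres) ∧ (Gursky-type obstruction
off them). [cite: ChangGurskyYang2003, Thm. A] [cite: Gursky1998, Thm. 1] -/
theorem crux_iff_split : ChangGurskyYang ↔ OnHomotopySpheres ∧ WeylObstructionOffSpheres := by
  constructor
  · intro h
    refine ⟨fun M _ _ _ _ _ _ _ _ hM ↦ h M hM, fun M _ _ _ _ _ _ _ hE hM ↦ ?_⟩
    obtain ⟨e⟩ := h M hM
    exact hE.false e.toHomeomorph.toHomotopyEquiv
  · rintro ⟨hOn, hOff⟩ M _ _ _ _ _ _ _ hM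
    by_cases hne : Nonempty (M ≃ₕ S⁴)
    · obtain ⟨e⟩ := hne
      exact hOn M e hM
    · exact absurd hM (hOff M (not_nonempty_iff.mp hne))

/-- **The homotopy-sphere fragment is a corollary of the summit**: SPC4 gives the diffeomorphism
from `M ≃ₕ S⁴` alone, ignoring the metric. So that half of the crux cannot be refuted short of
`¬ SPC4`. [folklore] -/
theorem spc4_implies_onHomotopySpheres (h : _root_.SmoothPoincare4) : OnHomotopySpheres :=
  fun M _ _ _ cs im _ _ e _ ↦ h M cs im e

/-- Conversely a refutation of the crux refutes SPC4 or the obstruction (Gursky 1998 in print).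
[cite: Gursky1998, Thm. 1] -/
theorem not_crux_imp (h : ¬ ChangGurskyYang) :
    ¬ _root_.SmoothPoincare4 ∨ ¬ WeylObstructionOffSpheres := by
  by_cases hs : _root_.SmoothPoincare4
  · exact Or.inr fun hO ↦ h (crux_iff_split.mpr ⟨spc4_implies_onHomotopySpheres hs, hO⟩)
  · exact Or.inl hs

/-- The same item is ALSO a decl of route WeylBudget (rank 9); the two route decls agree.
[cite: ChangGurskyYang2003, Thm. A] -/
theorem weylBudget_crux_iff :
    Summit.SmoothPoincare4.SmoothPoincare4.Theses.WeylBudget.ChangGurskyYang ↔ ChangGurskyYang :=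
  Iff.rfl

/-- **WeylBudget closes with the SPC4-implied fragment alone**: its deciding theorem
(`WeylBudget.closes : WeylLight → ChangGurskyYang → … → SPC4`) goes through verbatim with the crux
replaced by `OnHomotopySpheres` — the obstruction half of the crux is never used by that route.
[folklore] -/
theorem spc4_of_weylLight_of_onHomotopySpheres
    (hW : Summit.SmoothPoincare4.SmoothPoincare4.Theses.WeylBudget.WeylLight)
    (hOn : OnHomotopySpheres) : _root_.SmoothPoincare4 := by
  unfold _root_.SmoothPoincare4 Literature.SPC4.SmoothPoincareConjectureFour
    ContinuousMap.HomotopyEquiv.NonemptyDiffeomorphSphere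
  intro M _ _ _ _ _ e
  haveI : CompactSpace M :=
    Literature.Topology.FourManifolds.compactSpace_of_homotopyEquiv_sphere_four_holds M e
  haveI : SimplyConnectedSpace (Metric.sphere (0 : EuclideanSpace ℝ (Fin 5)) 1) :=
    Literature.Topology.FourManifolds.simplyConnectedSpace_sphere_four_holds
  haveI : SimplyConnectedSpace M := e.simplyConnectedSpace
  obtain ⟨o⟩ := Literature.Topology.FourManifolds.isOrientable_of_homotopyEquiv_sphere_four_holds M e
  obtain ⟨g, hLC, hg, hscal, hint⟩ :=
    hW { carrier := M, orientation := o, nonempty_homotopyEquiv := ⟨e⟩ }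
  exact hOn M e ⟨g, hLC, hg, hscal, hint⟩

/-! ## §2 Non-vacuity and the model case -/

/-- **The round `S⁴` satisfies the antecedent** (`R = 12 > 0`, `∫|W|² = 0 < 32π²`; tree theorem).
[cite: ChangGurskyYang2003, p. 106] -/
theorem hyps_round : Hyps S⁴ :=
  roundSphere_four_changGurskyYang_hypotheses (EuclideanSpace ℝ (Fin 5))

/-- The crux instance at `M = S⁴` is true outright (refl), so `S⁴` is no counterexample and the
antecedent is satisfiable: the crux is NOT vacuous. [folklore] -/
theorem crux_at_sphereFour : Hyps S⁴ → Nonempty (S⁴ ≃ₘ⟮𝓡 4, 𝓡 4⟯ S⁴) :=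
  fun _ ↦ ⟨Diffeomorph.refl _ _ _⟩

/-! ## §3a Compactness is load-bearing: the punctured round sphere on `ℝ⁴` -/

section WithoutCompact

open PuncturedSphereFour RoundCylinderFour

/-- The crux with `[CompactSpace M]` DROPPED. [cite: ChangGurskyYang2003, Thm. A] -/
def ChangGurskyYangWithoutCompact : Prop :=
  ∀ (M : Type) [TopologicalSpace M] [T2Space M] [SecondCountableTopology M]
    [ChartedSpace (EuclideanSpace ℝ (Fin 4)) M] [IsManifold (𝓡 4) ∞ M] [SimplyConnectedSpace M],
    Hyps M → Nonempty (M ≃ₘ⟮𝓡 4, 𝓡 4⟯ S⁴)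

/-- The flat metric `δ` on `ℝ⁴ = ↥⊤` has vanishing curvature tensor. [folklore] -/
theorem flatW_curvatureForm (x : W4) (a b c d : EuclideanFour) :
    flatW.curvatureForm flatW.leviCivita x a b c d = 0 := by
  rw [OpensChart.curvatureForm_eq_apply_riemAt flatW_val x, MetricCoord.riemAt_constMetric]
  simp

/-- Hence `|W_δ|² ≡ 0`. [folklore] -/
theorem flatW_weylNormSq (x : W4) : flatW.weylNormSq x = 0 := by
  refine flatW.weylNormSq_eq_zero x fun e _ i j k l ↦ ?_
  rw [weylFrame_apply]
  simp [flatW_curvatureForm, ricci_flatW, scalarCurvature_flatW]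

/-- `δ` is Riemannian. [folklore] -/
theorem isRiemannian_flatW : flatW.IsRiemannian := fun y v hv ↦ by
  rw [flatW_apply]; exact real_inner_self_pos.mpr hv

/-- **`|W|² ≡ 0` for the punctured sphere `g_p = e^{2w} δ`**: conformal covariance of the Weyl
norm (`weylNormSq_conformal_sq`, Besse 1.159) with `ψ = e^{w}`. [cite: Besse1987, Thm. 1.159] -/
theorem punctP_weylNormSq (x : W4) : punctP.weylNormSq x = 0 := by
  have h3 : 3 ≤ Module.finrank ℝ EuclideanFour := by
    rw [finrank_euclideanSpace_fin]; norm_num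
  have hψ : ContMDiff 𝓘(ℝ, EuclideanFour) 𝓘(ℝ) ∞
      (fun y : W4 ↦ Real.exp (wE (y : EuclideanFour))) :=
    (Real.contDiff_exp.comp contDiff_wE).contMDiff.comp contMDiff_subtype_val
  rw [weylNormSq_conformal_sq h3 flatW punctP isRiemannian_flatW hψ (fun y ↦ Real.exp_pos _) ?_ x,
    flatW_weylNormSq, mul_zero]
  intro y v w
  change Real.exp (2 * wE (y : EuclideanFour)) * innerSL ℝ (E := EuclideanFour) v w =
    Real.exp (wE (y : EuclideanFour)) ^ 2 * innerSL ℝ (E := EuclideanFour) v w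
  rw [sq, ← Real.exp_add, ← two_mul]

/-- **The punctured round sphere has zero Weyl energy.** [cite: Besse1987, Thm. 1.159] -/
theorem punctP_weylEnergy : punctP.weylEnergy = 0 :=
  punctP.weylEnergy_eq_zero_of_weylNormSq_eq_zero punctP_weylNormSq

/-- `ℝ⁴ = ↥⊤ ≃ₜ ℝ⁴`. [folklore] -/
def homeoW4 : W4 ≃ₜ EuclideanFour where
  toFun := Subtype.val
  invFun y := ⟨y, trivial⟩
  left_inv _ := rfl
  right_inv _ := rfl
  continuous_toFun := continuous_subtype_val
  continuous_invFun := continuous_id.subtype_mk _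

/-- `ℝ⁴` is contractible, hence simply connected. [folklore] -/
instance : ContractibleSpace W4 := homeoW4.contractibleSpace

/-- `ℝ⁴ ≇ S⁴`: a diffeomorphism would make the non-compact `ℝ⁴` compact. [folklore] -/
theorem not_diffeomorph_W4 : ¬ Nonempty (W4 ≃ₘ⟮𝓡 4, 𝓡 4⟯ S⁴) := by
  rintro ⟨e⟩
  haveI : CompactSpace W4 := e.toHomeomorph.symm.compactSpace
  exact not_compactSpace_iff.mpr (inferInstance : NoncompactSpace W4) ‹_›

/-- The punctured sphere satisfies the antecedent: smooth, Riemannian, `R = 2 > 0`, `∫|W|² = 0`.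
[cite: Lee2018, Ch. 3] -/
theorem hyps_punctP : Hyps W4 :=
  ⟨punctP, inferInstance, isRiemannian_punctP, fun x ↦ by rw [scalarCurvature_punctP]; norm_num,
    by rw [punctP_weylEnergy]; exact ENNReal.ofReal_pos.2 (by positivity)⟩

/-- **Compactness is load-bearing**: any proof of the crux must use `[CompactSpace M]` — with it
dropped, `(ℝ⁴, 96(|y|²+4)⁻²δ)` = `S⁴(√6) ∖ {pt}` is a counterexample. [cite: ChangGurskyYang2003, Thm. A] -/
theorem changGurskyYang_false_without_compact : ¬ ChangGurskyYangWithoutCompact :=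
  fun h ↦ not_diffeomorph_W4 (h W4 hyps_punctP)

end WithoutCompact

/-! ## §3b Simple connectivity is load-bearing: the round `ℝℙ⁴` -/

section WithoutSimplyConnected

/-- The ambient `ℝ⁵` of the tree's `𝕊 4`. -/
abbrev V5 : Type := EuclideanSpace ℝ (Fin (4 + 1))
/-- The round `S⁴` with Mathlib's manifold structure (`= S⁴` up to `Fin (4+1) = Fin 5`). -/
abbrev S4 : Type := sphere (0 : V5) 1

/-- `dim ℝ⁵ = 4 + 1`, as a `Fact` for the sphere API. [folklore] -/
instance factFinrankV5 : Fact (finrank ℝ V5 = 4 + 1) := ⟨finrank_euclideanSpace_fin⟩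

attribute [local instance] antipodalAction
attribute [local instance] continuousConstSMul_antipodal isCancelSMul_antipodal

/-- **`x ↦ -x` is an isometry of the round metric** (`g_y(v,w) = ⟪dι v, dι w⟫` and
`dι_{-y} ∘ d(neg)_y = d(-ι)_y = -dι_y`). [cite: ONeill1983, Ch. 3, Def. 3.4] -/
theorem roundMetric_neg (y : S4) (v w : TangentSpace (𝓡 4) y) :
    (roundMetric (n := 4) V5).val (-y) (mfderiv (𝓡 4) (𝓡 4) (fun x : S4 ↦ -x) y v)
      (mfderiv (𝓡 4) (𝓡 4) (fun x : S4 ↦ -x) y w) = (roundMetric (n := 4) V5).val y v w := by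
  rw [roundMetric_apply, roundMetric_apply]
  have hι : ContMDiff (𝓡 4) 𝓘(ℝ, V5) ∞ ((↑) : S4 → V5) := contMDiff_coe_sphere
  have hn : ContMDiff (𝓡 4) (𝓡 4) ∞ (fun x : S4 ↦ -x) := contMDiff_neg_sphere
  have hcomp : HasMFDerivAt (𝓡 4) 𝓘(ℝ, V5) (((↑) : S4 → V5) ∘ fun x : S4 ↦ -x) y
      ((mfderiv (𝓡 4) 𝓘(ℝ, V5) ((↑) : S4 → V5) (-y)).comp
        (mfderiv (𝓡 4) (𝓡 4) (fun x : S4 ↦ -x) y)) :=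
    HasMFDerivAt.comp y (hι.mdifferentiableAt (by simp)).hasMFDerivAt
      (hn.mdifferentiableAt (by simp)).hasMFDerivAt
  have hfun : (((↑) : S4 → V5) ∘ fun x : S4 ↦ -x) = -((↑) : S4 → V5) := by
    funext x; simp
  rw [hfun] at hcomp
  have key : ∀ z : TangentSpace (𝓡 4) y,
      ((mfderiv (𝓡 4) 𝓘(ℝ, V5) ((↑) : S4 → V5) (-y)
          (mfderiv (𝓡 4) (𝓡 4) (fun x : S4 ↦ -x) y z) : V5)) =
        -((mfderiv (𝓡 4) 𝓘(ℝ, V5) ((↑) : S4 → V5) y z : V5)) := by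
    intro z
    have h1 : mfderiv (𝓡 4) 𝓘(ℝ, V5) (-((↑) : S4 → V5)) y z =
        mfderiv (𝓡 4) 𝓘(ℝ, V5) ((↑) : S4 → V5) (-y)
          (mfderiv (𝓡 4) (𝓡 4) (fun x : S4 ↦ -x) y z) := by
      rw [hcomp.mfderiv]; rfl
    have h2 : mfderiv (𝓡 4) 𝓘(ℝ, V5) (-((↑) : S4 → V5)) y z =
        -(mfderiv (𝓡 4) 𝓘(ℝ, V5) ((↑) : S4 → V5) y z) := by
      rw [mfderiv_neg]; rfl
    exact h1.symm.trans h2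
  rw [key v, key w]
  exact @inner_neg_neg ℝ V5 _ _ _ _ _

/-- Transport of `roundMetric_neg` to any map equal to `x ↦ -x`. [folklore] -/
theorem roundMetric_inv_of_eq_neg {f : S4 → S4} (hf : f = fun x : S4 ↦ -x) (y : S4)
    (v w : TangentSpace (𝓡 4) y) :
    (roundMetric (n := 4) V5).val (f y) (mfderiv (𝓡 4) (𝓡 4) f y v)
      (mfderiv (𝓡 4) (𝓡 4) f y w) = (roundMetric (n := 4) V5).val y v w := by
  subst hf
  exact roundMetric_neg y v w

/-- The identity is an isometry. [folklore] -/
theorem roundMetric_inv_of_eq_id {f : S4 → S4} (hf : f = id) (y : S4)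
    (v w : TangentSpace (𝓡 4) y) :
    (roundMetric (n := 4) V5).val (f y) (mfderiv (𝓡 4) (𝓡 4) f y v)
      (mfderiv (𝓡 4) (𝓡 4) f y w) = (roundMetric (n := 4) V5).val y v w := by
  subst hf
  rw [mfderiv_id]
  rfl

/-- **The antipodal action `{±1} ↷ S⁴` is isometric** for the round metric (hypothesis `hinv` of
the tree's `quotientMetric`). [cite: Lee2018, Prop. 2.32] -/
theorem roundMetric_antipodal (u : ℤˣ) (y : S4) (v w : TangentSpace (𝓡 4) y) :
    (roundMetric (n := 4) V5).val (u • y) (mfderiv (𝓡 4) (𝓡 4) (fun x : S4 ↦ u • x) y v)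
      (mfderiv (𝓡 4) (𝓡 4) (fun x : S4 ↦ u • x) y w) = (roundMetric (n := 4) V5).val y v w := by
  rcases Int.units_eq_one_or u with rfl | rfl
  · exact roundMetric_inv_of_eq_id (funext fun x ↦ one_smul ℤˣ x) y v w
  · exact roundMetric_inv_of_eq_neg (funext fun x ↦ antipodalAction_neg_one_smul 4 x) y v w

/-- The antipodal maps are `C^∞` (tree). [folklore] -/
theorem contMDiff_antipodal : ∀ u : ℤˣ, ContMDiff (𝓡 4) (𝓡 4) ∞ (fun x : S4 ↦ u • x) :=
  contMDiff_antipodal_smul 4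

/-- `S⁴/±1` is a `C^∞` manifold (tree: `QuotientManifold.isManifold`); needed as an instance at the
orbit-space type for `quotientMetric`. [folklore] -/
instance instIsManifoldOrbitQuotient : IsManifold (𝓡 4) ∞ (MulAction.orbitRel.Quotient ℤˣ S4) :=
  Literature.Geometry.Manifold.QuotientManifold.isManifold (I := 𝓡 4) (n := ∞) (G := ℤˣ)
    (M := S4) contMDiff_antipodal

/-- **The round metric of `ℝℙ⁴ = S⁴/±1`** (Lee 2018, Prop. 2.32: the unique metric making the
projection a Riemannian covering; tree `quotientMetric`). [cite: Lee2018, Prop. 2.32] -/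
def rpMetric : PseudoRiemannianMetric (𝓡 4) ∞ (EuclideanSpace ℝ (Fin 4))
    (TangentSpace (𝓡 4) : RealProjectiveSpace 4 → Type _) :=
  QuotientMetric.quotientMetric (G := ℤˣ) (M := S4) (I := 𝓡 4) (roundMetric (n := 4) V5)
    contMDiff_antipodal roundMetric_antipodal

/-- Levi-Civita connection of `rpMetric` (tree theorem `hasLeviCivita`). [folklore] -/
instance : (rpMetric).HasLeviCivita := rpMetric.hasLeviCivita

/-- `rpMetric` is Riemannian. [cite: Lee2018, Prop. 2.32] -/
theorem isRiemannian_rpMetric : rpMetric.IsRiemannian :=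
  QuotientMetric.isRiemannian_quotientMetric (G := ℤˣ) (M := S4) (I := 𝓡 4)
    (roundMetric (n := 4) V5) contMDiff_antipodal roundMetric_antipodal isRiemannian_roundMetric

/-- Smoothness of pulled-back bilinear forms (tree theorem), at the types used here. [folklore] -/
theorem hpbRP : contMDiff_pullbackBilin (𝓡 4) (RealProjectiveSpace 4) (𝓡 4) S4 ∞ :=
  contMDiff_pullbackBilin_holds

/-- The projection `S⁴ → ℝℙ⁴`. [folklore] -/
abbrev mkRP : S4 → RealProjectiveSpace 4 := RealProjectiveSpace.mk 4

/-- The projection is `C^{∞+1}`. [folklore] -/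
theorem contMDiff_mkRP : ContMDiff (𝓡 4) (𝓡 4) (∞ + 1) mkRP :=
  QuotientMetric.contMDiff_mk_infty_add_one (G := ℤˣ) (M := S4) (I := 𝓡 4) contMDiff_antipodal

/-- The projection is an immersion. [folklore] -/
theorem injective_mfderiv_mkRP : ∀ y : S4, Injective (mfderiv (𝓡 4) (𝓡 4) mkRP y) :=
  QuotientMetric.injective_mfderiv_mk (G := ℤˣ) (M := S4) (I := 𝓡 4) contMDiff_antipodal

/-- **`mk^* ḡ = g_round`**: the projection is a local isometry (tree `comap_mk_quotientMetric`).
[cite: Lee2018, Prop. 2.32] -/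
theorem comap_rpMetric :
    rpMetric.comap hpbRP mkRP contMDiff_mkRP injective_mfderiv_mkRP rfl = roundMetric (n := 4) V5 :=
  QuotientMetric.comap_mk_quotientMetric (G := ℤˣ) (M := S4) (I := 𝓡 4)
    (roundMetric (n := 4) V5) contMDiff_antipodal roundMetric_antipodal

/-- **The round `ℝℙ⁴` has constant sectional curvature `1`** (descent along the surjective local
isometry `S⁴ → ℝℙ⁴`, tree `hasConstantSectionalCurvature_of_comap_of_surjective`).
[cite: Lee2018, Prop. 8.36] -/
theorem hasConstantSectionalCurvature_rpMetric : rpMetric.HasConstantSectionalCurvature 1 := by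
  refine hasConstantSectionalCurvature_of_comap_of_surjective rpMetric hpbRP contMDiff_mkRP
    injective_mfderiv_mkRP rfl (RealProjectiveSpace.mk_surjective 4) ?_
  rw [comap_rpMetric]
  exact hasConstantSectionalCurvature_roundMetric V5

/-- Hence `∫|W|² = 0` on the round `ℝℙ⁴`. [cite: Besse1987, 1.118–1.119] -/
theorem weylEnergy_rpMetric : rpMetric.weylEnergy = 0 :=
  hasConstantSectionalCurvature_rpMetric.weylEnergy_eq_zero
    (by rw [finrank_euclideanSpace_fin]; norm_num)

/-- And `R ≡ 12` on the round `ℝℙ⁴`. [cite: Lee2018, Prop. 8.36] -/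
theorem scalarCurvature_rpMetric (p : RealProjectiveSpace 4) : rpMetric.scalarCurvature p = 12 := by
  classical
  obtain ⟨b, hb⟩ := rpMetric.exists_basis_isOrthonormalFrame (x := p) (isRiemannian_rpMetric p)
    (finrank_euclideanSpace_fin (𝕜 := ℝ) (n := 4))
  rw [(hasConstantSectionalCurvature_rpMetric.with
    rpMetric.isLeviCivita_leviCivita_holds).scalarCurvature_eq_of_basis b hb]
  norm_num

/-- The round `ℝℙ⁴` satisfies the antecedent of the crux. [cite: ChangGurskyYang2003, Thm. A] -/
theorem hyps_rpMetric : Hyps (RealProjectiveSpace 4) :=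
  ⟨rpMetric, inferInstance, isRiemannian_rpMetric, fun p ↦ by rw [scalarCurvature_rpMetric]; norm_num,
    by rw [weylEnergy_rpMetric]; exact ENNReal.ofReal_pos.2 (by positivity)⟩

/-- **`ℝℙ⁴ ≇ S⁴`**: `S⁴` is simply connected (tree), `ℝℙ⁴` is not (tree, `π₁ = ℤ₂`).
[cite: HatcherAT2002, Example 1.43] -/
theorem not_diffeomorph_rp4 : ¬ Nonempty (RealProjectiveSpace 4 ≃ₘ⟮𝓡 4, 𝓡 4⟯ S⁴) := by
  rintro ⟨e⟩
  haveI : SimplyConnectedSpace S⁴ := simplyConnectedSpace_euclideanSphere (n := 4) (by norm_num)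
  exact (isRealProjectiveSpace_realProjectiveSpace 4).not_simplyConnectedSpace (by norm_num)
    e.toHomeomorph.toHomotopyEquiv.simplyConnectedSpace

/-- `ℝℙ⁴` is connected (image of the connected `S⁴`). [folklore] -/
instance : ConnectedSpace (RealProjectiveSpace 4) := by
  haveI : ConnectedSpace S4 := by
    refine isConnected_iff_connectedSpace.mp (isConnected_sphere ?_ (0 : V5) zero_le_one)
    rw [← Module.finrank_eq_rank, finrank_euclideanSpace_fin]
    norm_num
  exact (RealProjectiveSpace.mk_surjective 4).connectedSpace (RealProjectiveSpace.contMDiff_mk 4).continuous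

/-- The crux with `[SimplyConnectedSpace M]` WEAKENED to `[ConnectedSpace M]`.
[cite: ChangGurskyYang2003, Thm. A] -/
def ChangGurskyYangWithoutSimplyConnected : Prop :=
  ∀ (M : Type) [TopologicalSpace M] [T2Space M] [SecondCountableTopology M]
    [ChartedSpace (EuclideanSpace ℝ (Fin 4)) M] [IsManifold (𝓡 4) ∞ M] [CompactSpace M]
    [ConnectedSpace M], Hyps M → Nonempty (M ≃ₘ⟮𝓡 4, 𝓡 4⟯ S⁴)

/-- **Simple connectivity is load-bearing** (even weakened to connectedness): the round `ℝℙ⁴`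
(`R = 12`, `W = 0`) is a counterexample — it is CGY's second alternative "or `ℝP⁴`".
[cite: ChangGurskyYang2003, Thm. A] -/
theorem changGurskyYang_false_without_simplyConnected : ¬ ChangGurskyYangWithoutSimplyConnected :=
  fun h ↦ not_diffeomorph_rp4 (h (RealProjectiveSpace 4) hyps_rpMetric)

end WithoutSimplyConnected

/-! ## §3c–d The remaining hypotheses (PAPER) -/

/-- The crux with `0 < scalarCurvature` DROPPED. STATUS: PAPER-OPEN (no kill known to this refuter).
A counterexample needs a closed simply connected `M ≄ S⁴` and a metric with `∫|W|²_(0,4) < 32π²`;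
signature forces `τ(M) = 0` (`∫|W^±|²_(0,4) ≥ 48π²|τ|` for all metrics), and on `S²×S²`-type manifolds
the infimum of the conformally invariant Weyl functional over NEGATIVE Yamabe classes is not known
(Gursky 1998 needs `Y ≥ 0`; SW-based bounds are void on `S²×S²`). On homotopy spheres it is SPC4-implied.
[cite: Gursky1998, Thm. 1] -/
def ChangGurskyYangWithoutScalarPos : Prop :=
  ∀ (M : Type) [TopologicalSpace M] [T2Space M] [SecondCountableTopology M]
    [ChartedSpace (EuclideanSpace ℝ (Fin 4)) M] [IsManifold (𝓡 4) ∞ M] [CompactSpace M]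
    [SimplyConnectedSpace M],
    (∃ g : PseudoRiemannianMetric (𝓡 4) ∞ (EuclideanSpace ℝ (Fin 4)) (TangentSpace (𝓡 4) : M → Type _),
      ∃ _ : g.HasLeviCivita, g.IsRiemannian ∧ g.weylEnergy < ENNReal.ofReal (32 * Real.pi ^ 2)) →
    Nonempty (M ≃ₘ⟮𝓡 4, 𝓡 4⟯ S⁴)

/-- `WithoutScalarPos` trivially implies the crux (it has fewer hypotheses); the converse is the open
direction. [folklore] -/
theorem crux_of_withoutScalarPos (h : ChangGurskyYangWithoutScalarPos) : ChangGurskyYang :=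
  fun M _ _ _ _ _ _ _ ⟨g, hLC, hg, _, hW⟩ ↦ h M ⟨g, hLC, hg, hW⟩

/-- The crux with `g.IsRiemannian` DROPPED. STATUS: JUNK-false on PAPER — for a non-Riemannian `g`
the tree DEFINES `g.weylEnergy = 0` (`weylEnergy_of_not_isRiemannian`), so a neutral-signature metric
of positive "scalar curvature" on any closed simply connected `M ≄ S⁴` (e.g. `S²(1)×S²(2)` with
`g₁ ⊕ (−g₂)`, `R = 2 − ½`) kills it; not Lean-constructible today (no product metric modelled on
`𝓡 4`). The conjunct is therefore needed, and harmless. [folklore] -/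
def ChangGurskyYangWithoutRiemannian : Prop :=
  ∀ (M : Type) [TopologicalSpace M] [T2Space M] [SecondCountableTopology M]
    [ChartedSpace (EuclideanSpace ℝ (Fin 4)) M] [IsManifold (𝓡 4) ∞ M] [CompactSpace M]
    [SimplyConnectedSpace M],
    (∃ g : PseudoRiemannianMetric (𝓡 4) ∞ (EuclideanSpace ℝ (Fin 4)) (TangentSpace (𝓡 4) : M → Type _),
      ∃ _ : g.HasLeviCivita, (∀ x, 0 < g.scalarCurvature x) ∧
        g.weylEnergy < ENNReal.ofReal (32 * Real.pi ^ 2)) →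
    Nonempty (M ≃ₘ⟮𝓡 4, 𝓡 4⟯ S⁴)

/-- The junk that `WithoutRiemannian` exposes: a non-Riemannian `g` has Weyl energy `0 < 32π²` by
DEFINITION, whatever its curvature. [folklore] -/
theorem weylEnergy_lt_of_not_isRiemannian {M : Type} [TopologicalSpace M] [T2Space M]
    [ChartedSpace (EuclideanSpace ℝ (Fin 4)) M] [IsManifold (𝓡 4) ∞ M]
    (g : PseudoRiemannianMetric (𝓡 4) ∞ (EuclideanSpace ℝ (Fin 4)) (TangentSpace (𝓡 4) : M → Type _))
    [g.HasLeviCivita] (hg : ¬ g.IsRiemannian) :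
    g.weylEnergy < ENNReal.ofReal (32 * Real.pi ^ 2) := by
  rw [g.weylEnergy_of_not_isRiemannian hg]
  exact ENNReal.ofReal_pos.2 (by positivity)

/-- The crux with the Weyl-energy bound DROPPED ("psc ⇒ `S⁴`"). STATUS: PAPER-false — `(ℂP², g_FS)`
and `S²×S²` are closed, simply connected, psc and not homotopy spheres; no kernel witness yet (the tree
has `ComplexProjectiveSpace 2` and its homology but neither the Fubini–Study METRIC nor product metrics
on `𝓡 4`). [cite: ChangGurskyYang2003, Thm. B] -/
def ChangGurskyYangWithoutWeylBound : Prop :=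
  ∀ (M : Type) [TopologicalSpace M] [T2Space M] [SecondCountableTopology M]
    [ChartedSpace (EuclideanSpace ℝ (Fin 4)) M] [IsManifold (𝓡 4) ∞ M] [CompactSpace M]
    [SimplyConnectedSpace M],
    (∃ g : PseudoRiemannianMetric (𝓡 4) ∞ (EuclideanSpace ℝ (Fin 4)) (TangentSpace (𝓡 4) : M → Type _),
      ∃ _ : g.HasLeviCivita, g.IsRiemannian ∧ (∀ x, 0 < g.scalarCurvature x)) →
    Nonempty (M ≃ₘ⟮𝓡 4, 𝓡 4⟯ S⁴)

/-- `WithoutWeylBound` trivially implies the crux; the converse is the (paper-false) content. [folklore] -/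
theorem crux_of_withoutWeylBound (h : ChangGurskyYangWithoutWeylBound) : ChangGurskyYang :=
  fun M _ _ _ _ _ _ _ ⟨g, hLC, hg, hR, _⟩ ↦ h M ⟨g, hLC, hg, hR⟩

/-! ## §4 Strengthenings: the threshold -/

/-- The crux with threshold `32π²` replaced by `c`. [cite: ChangGurskyYang2003, Thm. A] -/
def ChangGurskyYangBelow (c : ENNReal) : Prop :=
  ∀ (M : Type) [TopologicalSpace M] [T2Space M] [SecondCountableTopology M]
    [ChartedSpace (EuclideanSpace ℝ (Fin 4)) M] [IsManifold (𝓡 4) ∞ M] [CompactSpace M]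
    [SimplyConnectedSpace M],
    (∃ g : PseudoRiemannianMetric (𝓡 4) ∞ (EuclideanSpace ℝ (Fin 4)) (TangentSpace (𝓡 4) : M → Type _),
      ∃ _ : g.HasLeviCivita, g.IsRiemannian ∧ (∀ x, 0 < g.scalarCurvature x) ∧ g.weylEnergy < c) →
    Nonempty (M ≃ₘ⟮𝓡 4, 𝓡 4⟯ S⁴)

/-- `c = 32π²` is the crux. [cite: ChangGurskyYang2003, Thm. A] -/
theorem below_32_iff : ChangGurskyYangBelow (ENNReal.ofReal (32 * Real.pi ^ 2)) ↔ ChangGurskyYang :=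
  Iff.rfl

/-- Smaller thresholds follow from the crux. PAPER: `c > 48π²` is FALSE by `(ℂP², g_FS)` (`R = 24`,
`∫|W|²_(0,4) = 48π² = 16π²χ(ℂP²)`, CGY 2003 p. 106 "Theorem A is sharp"); `32π² < c ≤ 48π²` is the
crux plus an SPC4-type statement on homotopy spheres. [cite: ChangGurskyYang2003, p. 106] -/
theorem below_of_le (h : ChangGurskyYang) {c : ENNReal} (hc : c ≤ ENNReal.ofReal (32 * Real.pi ^ 2)) :
    ChangGurskyYangBelow c :=
  fun M _ _ _ _ _ _ _ ⟨g, hLC, hg, hR, hW⟩ ↦ h M ⟨g, hLC, hg, hR, hW.trans_le hc⟩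

/-- Calibration of the sharpness witness `(ℂP², g_FS)` (`Ric = 6g`, `Vol = π²/2`,
`|W|²_(0,4) = 4·|W⁺|²_End = 4 · R²/24 = 96` at `R = 24`): `∫|W|² = 96 · π²/2 = 48π² = 16π²·χ(ℂP²)`,
above the typed bar `32π²`. [cite: ChangGurskyYang2003, p. 106] -/
theorem fubiniStudy_weylEnergy_arith :
    (4 : ℝ) * (24 ^ 2 / 24) * (Real.pi ^ 2 / 2) = 16 * Real.pi ^ 2 * 3 ∧
      32 * Real.pi ^ 2 < (4 : ℝ) * (24 ^ 2 / 24) * (Real.pi ^ 2 / 2) := by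
  constructor
  · ring
  · nlinarith [Real.pi_pos, Real.pi_gt_three]

/-- Calibration on products `S²(a) × S²(b)` (`|W|²_End = R²/12`, `R = 2/a² + 2/b²`, `Vol = 16π²a²b²`):
`∫|W|²_(0,4) = (64π²/3)(a²+b²)²/(a²b²) ≥ 256π²/3 > 64π² = 16π²χ(S²×S²)` — consistent with the
crux, no product is a counterexample (AM–GM). [cite: Gursky1998, Thm. 1] -/
theorem product_weylEnergy_ge (a b : ℝ) (ha : 0 < a) (hb : 0 < b) :
    64 * Real.pi ^ 2 < 64 * Real.pi ^ 2 / 3 * (a ^ 2 + b ^ 2) ^ 2 / (a ^ 2 * b ^ 2) := by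
  have hab : 0 < a ^ 2 * b ^ 2 := by positivity
  rw [lt_div_iff₀ hab]
  nlinarith [sq_nonneg (a ^ 2 - b ^ 2), Real.pi_pos, mul_pos (mul_pos ha ha) (mul_pos hb hb),
    sq_nonneg (a * b), mul_pos (pow_pos Real.pi_pos 2) hab]

/-! ## §5 Junk probes -/

/-- **The antecedent is scale-invariant** (`(c·g)` is Riemannian, `R_{cg} = c⁻¹R_g > 0`,
`∫|W_{cg}|² dV_{cg} = ∫|W_g|² dV_g` in dimension `4`): shrinking a metric (e.g. on `ℂP²`) cannot push
its Weyl energy under the bar — the "wrong number of `g⁻¹`'s" junk attack is closed by the tree.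
[cite: ChangGurskyYang2003, p. 105 and (0.3)] -/
theorem hyps_constSmul {M : Type} [TopologicalSpace M] [T2Space M]
    [ChartedSpace (EuclideanSpace ℝ (Fin 4)) M] [IsManifold (𝓡 4) ∞ M]
    (g : PseudoRiemannianMetric (𝓡 4) ∞ (EuclideanSpace ℝ (Fin 4)) (TangentSpace (𝓡 4) : M → Type _))
    [g.HasLeviCivita] (hg : g.IsRiemannian) (hR : ∀ x, 0 < g.scalarCurvature x)
    (hW : g.weylEnergy < ENNReal.ofReal (32 * Real.pi ^ 2)) {c : ℝ} (hc : 0 < c) :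
    haveI := HasLeviCivita.constSmul (g := g) c hc.ne'
    (g.constSmul c hc.ne').IsRiemannian ∧ (∀ x, 0 < (g.constSmul c hc.ne').scalarCurvature x) ∧
      (g.constSmul c hc.ne').weylEnergy < ENNReal.ofReal (32 * Real.pi ^ 2) := by
  haveI := HasLeviCivita.constSmul (g := g) c hc.ne'
  refine ⟨fun x v hv ↦ ?_, fun x ↦ ?_, ?_⟩
  · rw [constSmul_apply]; exact mul_pos hc (hg x v hv)
  · rw [scalarCurvature_constSmul]; exact mul_pos (inv_pos.mpr hc) (hR x)
  · rwa [weylEnergy_constSmul_four hc]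

/-- The supremum defining `|W|²(x)` is attained by every orthonormal `4`-frame (no `sSup`-junk):
tree theorem `weylNormSq_eq_weylNormSqFrame_four`, restated at the crux's types. [cite: Besse1987, 1.117] -/
theorem weylNormSq_attained {M : Type} [TopologicalSpace M]
    [ChartedSpace (EuclideanSpace ℝ (Fin 4)) M] [IsManifold (𝓡 4) ∞ M]
    (g : PseudoRiemannianMetric (𝓡 4) ∞ (EuclideanSpace ℝ (Fin 4)) (TangentSpace (𝓡 4) : M → Type _))
    [g.HasLeviCivita] (x : M) (e : Fin 4 → TangentSpace (𝓡 4) x)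
    (he : g.IsOrthonormalFrame x e) : g.weylNormSq x = g.weylNormSqFrame x e :=
  g.weylNormSq_eq_weylNormSqFrame_four finrank_euclideanSpace_fin he

/-- The Weyl energy of a smooth metric on a CLOSED `4`-manifold is finite, so `< 32π²` is a condition
on a real number (tree theorem `weylEnergy_lt_top`). [cite: ChangGurskyYang2003, (0.3)] -/
theorem weylEnergy_finite {M : Type} [TopologicalSpace M] [T2Space M] [SecondCountableTopology M]
    [ChartedSpace (EuclideanSpace ℝ (Fin 4)) M] [IsManifold (𝓡 4) ∞ M] [CompactSpace M]
    (g : PseudoRiemannianMetric (𝓡 4) ∞ (EuclideanSpace ℝ (Fin 4)) (TangentSpace (𝓡 4) : M → Type _))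
    [g.HasLeviCivita] (hg : g.IsRiemannian) : g.weylEnergy < ⊤ :=
  g.weylEnergy_lt_top hg

/-! ## §6 Binder hygiene (gen 2): two binders of the crux carry no content -/

section Binders

/-- The crux with `[SecondCountableTopology M]` DROPPED. [cite: ChangGurskyYang2003, Thm. A] -/
def ChangGurskyYangWithoutSecondCountable : Prop :=
  ∀ (M : Type) [TopologicalSpace M] [T2Space M]
    [ChartedSpace (EuclideanSpace ℝ (Fin 4)) M] [IsManifold (𝓡 4) ∞ M] [CompactSpace M]
    [SimplyConnectedSpace M], Hyps M → Nonempty (M ≃ₘ⟮𝓡 4, 𝓡 4⟯ S⁴)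

/-- A compact manifold charted on `ℝ⁴` is second countable (finitely many charts; Mathlib's
`ChartedSpace.secondCountable_of_sigmaCompact`). [folklore] -/
theorem secondCountable_of_compact (M : Type) [TopologicalSpace M]
    [ChartedSpace (EuclideanSpace ℝ (Fin 4)) M] [CompactSpace M] : SecondCountableTopology M :=
  ChartedSpace.secondCountable_of_sigmaCompact (EuclideanSpace ℝ (Fin 4)) M

/-- **`[SecondCountableTopology M]` is NOT load-bearing** — it is a CONSEQUENCE of the other
binders (compact + charted on `ℝ⁴`), so the crux with it dropped is EQUIVALENT to the crux.
Information for provers: no proof step may genuinely need it. [folklore] -/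
theorem crux_iff_withoutSecondCountable :
    ChangGurskyYang ↔ ChangGurskyYangWithoutSecondCountable := by
  constructor
  · intro h M _ _ _ _ _ _ hM
    haveI := secondCountable_of_compact M
    exact h M hM
  · intro h M _ _ _ _ _ _ _ hM
    exact h M hM

attribute [local instance] PseudoRiemannianMetric.hasLeviCivita in
/-- The crux with the binder `∃ _ : g.HasLeviCivita` REMOVED: the Levi-Civita instance is the
THEOREM `g.hasLeviCivita` (here a local instance), so `scal_g` and `∫|W_g|²` need no hypothesis.
[cite: ChangGurskyYang2003, Thm. A] -/
def ChangGurskyYangNoLCBinder : Prop :=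
  ∀ (M : Type) [TopologicalSpace M] [T2Space M] [SecondCountableTopology M]
    [ChartedSpace (EuclideanSpace ℝ (Fin 4)) M] [IsManifold (𝓡 4) ∞ M] [CompactSpace M]
    [SimplyConnectedSpace M],
    (∃ g : PseudoRiemannianMetric (𝓡 4) ∞ (EuclideanSpace ℝ (Fin 4)) (TangentSpace (𝓡 4) : M → Type _),
      g.IsRiemannian ∧ (∀ x, 0 < g.scalarCurvature x) ∧
        g.weylEnergy < ENNReal.ofReal (32 * Real.pi ^ 2)) →
    Nonempty (M ≃ₘ⟮𝓡 4, 𝓡 4⟯ S⁴)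

/-- **The `∃ _ : g.HasLeviCivita` binder is cosmetic**: `HasLeviCivita` is a `Prop` (a `Fact`),
so every instance is definitionally `g.hasLeviCivita` (proof irrelevance) and the crux is
EQUIVALENT to its binder-free form. No loophole (the connection is pinned by `g` through the
Koszul formula) and no burden. [folklore] -/
theorem crux_iff_noLCBinder : ChangGurskyYang ↔ ChangGurskyYangNoLCBinder := by
  constructor
  · rintro h M _ _ _ _ _ _ _ ⟨g, hg, hR, hW⟩
    exact h M ⟨g, g.hasLeviCivita, hg, hR, hW⟩
  · rintro h M _ _ _ _ _ _ _ ⟨g, hLC, hg, hR, hW⟩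
    exact h M ⟨g, hg, hR, hW⟩

end Binders

/-! ## §7 Pre-emptive targets (gen 2): the three LEAVES of the tree's reduction

Every round-1 idea card for this crux (margerin-*, gv-*, neck-exclusion, noncollapsed-round-limit)
discharges one of the three hypotheses of the kernel-checked reduction
`changGurskyYang_sphere_four_of_margerin_of_chernGaussBonnet_of_thm14` (ChangGurskyYangProofs.lean,
§2 of CGY 2003 line by line). Those hypotheses are therefore the de-facto STUBS of every line, and
the standing adversary audits them here, before a line is picked:

* `MargerinLeaf` (= `hMargerin` verbatim): TRUE in print (Margerin 1998, Thm. 1; CGY 2003 p. 106,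
  page-read this session: "if `R > 0` and `WP < 1/6`, then `M⁴` is diffeomorphic to either `S⁴` or
  `ℝP⁴`", `WP = (|W|² + 2|E|²)/R²` with `(0,4)`-norms, sharp: `(ℂP², g_FS)` and `(S³×S¹, g_prod)`
  have `R > 0`, `WP ≡ 1/6` — so the STRICT `<` is load-bearing: `MargerinLeafNonStrict` below is
  PAPER-false). Binder audit: `[ConnectedSpace M]` present (needed: `S⁴ ⊔ S⁴` is weakly pinched),
  `R > 0` present (it also keeps `weakPinching` away from its junk branch `x/0 = 0`).
* `CGBLeaf` (= `hCGB` verbatim): TRUE in print (Chern–Gauss–Bonnet (0.4)/(1.1) + `χ = 2 + b₂ ≥ 2`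
  for closed simply connected `M`, Hatcher 3.30). It only asserts SOME natural `χ ≥ 2`, weaker than
  CGB and enough.
* `Thm14Leaf` (= `hThm14` verbatim): **FALSE AS TYPED** (PAPER) — the binder omits
  `[ConnectedSpace M]` (CGY's "smooth, closed four-manifold" is connected by convention). Witness:
  `M = S⁴_round ⊔ (S³×S¹)_prod` (both conformally flat, `W ≡ 0`): `Y(M,[g₀]) ≥ min(Y(S⁴), Y(S³×S¹)) > 0`
  (both pieces have `R > 0`; the tree's `yamabeConstant` is the metric-form infimum, additive pieces
  estimate `(A₁+A₂)/(V₁+V₂)^{1/2} ≥ min Yᵢ`), `¼∫|W|² = 0 < ∫σ₂(A) = 16π² + 0` (`σ₂ = R²/24 - ½|E|²`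
  is `6` on `S⁴(1)` and `36/24 - 3/2 = 0` on `S³(1)×S¹`), yet NO conformal `g = e^{2w}g₀` has
  `σ₂(A_g) - ¼|W_g|² = σ₂(A_g) > 0` pointwise on the `S³×S¹` component, because `∫σ₂(A_g) dV_g` is a
  conformal invariant there (CGY 2003 p. 110: "the conformal invariance of the Weyl tensor implies
  that `∫σ₂(A) dvol` is conformally invariant as well"; equivalently CGB on `S³×S¹`, `χ = 0`) and
  equals `0`. (`S⁴ ⊔ ℂP²` works the same way: `∫σ₂ - ¼∫|W|² = 12π² - 12π² = 0` on `ℂP²`.)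
  REPAIR (kernel-checked below): the reduction needs Thm. 1.4 only for CONNECTED `M` —
  `Thm14LeafConnected` — and even only in the ideators' `scal > 0`-in/`scal > 0`-out shape
  `Thm14LeafPsc` (= card gv-continuity-path's `thm14_gurskyViaclovsky` verbatim):
  `crux_of_leaves_connected`, `crux_of_leaves_psc`. A lead must NOT register `hThm14` verbatim as a
  stub; `Thm14Leaf → Thm14LeafConnected → Thm14LeafPsc` (`thm14LeafConnected_of_thm14Leaf`,
  `thm14LeafPsc_of_connected`), so nothing is lost.
-/

section Leaves

open MeasureTheory

/-- MARGERIN'S LEAF, verbatim the hypothesis `hMargerin` of the tree's reduction (Margerin 1998,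
Thm. 1: closed connected `4`-manifold, `C^∞` Riemannian `g`, `R > 0`, `WP < 1/6` pointwise ⇒
`S⁴` or standard `ℝP⁴`). TRUE in print. [cite: Margerin1998, Thm. 1] -/
def MargerinLeaf : Prop :=
  ∀ (M : Type) [TopologicalSpace M] [T2Space M] [SecondCountableTopology M]
    [ChartedSpace (EuclideanSpace ℝ (Fin 4)) M] [IsManifold (𝓡 4) ∞ M] [CompactSpace M]
    [ConnectedSpace M]
    (g : PseudoRiemannianMetric (𝓡 4) ∞ (EuclideanSpace ℝ (Fin 4)) (TangentSpace (𝓡 4) : M → Type _))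
    [g.HasLeviCivita], g.IsRiemannian → (∀ x, 0 < g.scalarCurvature x) →
    (∀ x, g.weakPinching x < 1 / 6) →
    Nonempty (M ≃ₘ⟮𝓡 4, 𝓡 4⟯ S⁴) ∨ IsRealProjectiveSpace 4 M

/-- Margerin's leaf with `WP < 1/6` WEAKENED to `WP ≤ 1/6`. PAPER-FALSE (the constant is sharp):
`(S³×S¹, g_prod)` has `R = 6 > 0`, `W = 0`, `|E|² = 3`, `WP ≡ 1/6`, `π₁ = ℤ` (so neither `S⁴` nor
`ℝP⁴`); `(ℂP², g_FS)` has `E = 0`, `|W|² = 96`, `R = 24`, `WP ≡ 1/6` (CGY 2003, p. 106, quoting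
Margerin's holonomy-reduction converse: `WP ≡ 1/6` characterises these and their quotients). No
kernel witness yet (needs `S³×S¹ = (ℝ⁴∖0)/2^ℤ` with the quotient cylinder metric, or `g_FS`).
[cite: ChangGurskyYang2003, p. 106] [cite: Margerin1998, Thm. 1] -/
def MargerinLeafNonStrict : Prop :=
  ∀ (M : Type) [TopologicalSpace M] [T2Space M] [SecondCountableTopology M]
    [ChartedSpace (EuclideanSpace ℝ (Fin 4)) M] [IsManifold (𝓡 4) ∞ M] [CompactSpace M]
    [ConnectedSpace M]
    (g : PseudoRiemannianMetric (𝓡 4) ∞ (EuclideanSpace ℝ (Fin 4)) (TangentSpace (𝓡 4) : M → Type _))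
    [g.HasLeviCivita], g.IsRiemannian → (∀ x, 0 < g.scalarCurvature x) →
    (∀ x, g.weakPinching x ≤ 1 / 6) →
    Nonempty (M ≃ₘ⟮𝓡 4, 𝓡 4⟯ S⁴) ∨ IsRealProjectiveSpace 4 M

/-- The non-strict leaf trivially implies Margerin's leaf; the converse direction is where the
sharpness examples live. [folklore] -/
theorem margerinLeaf_of_nonStrict (h : MargerinLeafNonStrict) : MargerinLeaf :=
  fun M _ _ _ _ _ _ _ g _ hg hR hWP ↦ h M g hg hR fun x ↦ (hWP x).le

/-- THE CHERN–GAUSS–BONNET LEAF, verbatim the hypothesis `hCGB` of the tree's reduction: for every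
`C^∞` Riemannian metric on a closed simply connected `4`-manifold there is a natural `χ ≥ 2` with
`8π²χ = ¼∫|W|² + ∫σ₂(A)`. TRUE in print (CGB (0.4)/(1.1); `χ(M) = 2 + b₂`, Hatcher 3.30).
[cite: ChangGurskyYang2003, (1.1)] [cite: HatcherAT2002, Thm. 3.30] -/
def CGBLeaf : Prop :=
  ∀ (M : Type) [TopologicalSpace M] [T2Space M] [SecondCountableTopology M]
    [ChartedSpace (EuclideanSpace ℝ (Fin 4)) M] [IsManifold (𝓡 4) ∞ M] [CompactSpace M]
    [SimplyConnectedSpace M]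
    (g : PseudoRiemannianMetric (𝓡 4) ∞ (EuclideanSpace ℝ (Fin 4)) (TangentSpace (𝓡 4) : M → Type _))
    [g.HasLeviCivita], g.IsRiemannian →
    ∃ χ : ℕ, 2 ≤ χ ∧
      8 * Real.pi ^ 2 * χ = 1 / 4 * g.weylEnergy.toReal + g.sigma2WeylSchoutenIntegral

/-- THEOREM 1.4 LEAF, verbatim the hypothesis `hThm14` of the tree's reduction (CGY 2003, Thm. 1.4,
`α = 1`) — note the binder has NO `[ConnectedSpace M]`. **PAPER-FALSE as typed** (witness
`S⁴ ⊔ S³×S¹`, see the section docstring); the printed theorem is about connected manifolds.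
[cite: ChangGurskyYang2003, Thm. 1.4] -/
def Thm14Leaf : Prop :=
  ∀ (M : Type) [TopologicalSpace M] [T2Space M] [SecondCountableTopology M]
    [ChartedSpace (EuclideanSpace ℝ (Fin 4)) M] [IsManifold (𝓡 4) ∞ M] [CompactSpace M]
    [MeasurableSpace M] [BorelSpace M]
    (g₀ : PseudoRiemannianMetric (𝓡 4) ∞ (EuclideanSpace ℝ (Fin 4)) (TangentSpace (𝓡 4) : M → Type _))
    [g₀.HasLeviCivita] (hg₀ : g₀.IsRiemannian),
    0 < yamabeConstant (g₀.toContMDiffRiemannianMetric hg₀) →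
    1 / 4 * g₀.weylEnergy.toReal < g₀.sigma2WeylSchoutenIntegral →
    ∃ (g : PseudoRiemannianMetric (𝓡 4) ∞ (EuclideanSpace ℝ (Fin 4)) (TangentSpace (𝓡 4) : M → Type _))
      (_ : g.HasLeviCivita) (hg : g.IsRiemannian),
      IsConformalTo (g.toContMDiffRiemannianMetric hg) (g₀.toContMDiffRiemannianMetric hg₀) ∧
      ∀ x, 1 / 4 * g.weylNormSq x < g.sigma2WeylSchouten x

/-- **The three leaves give the crux** (this is the tree's reduction theorem, restated on the crux
decl through `crux_iff_fact`). [cite: ChangGurskyYang2003, §2, p. 121] -/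
theorem crux_of_leaves (h₁ : MargerinLeaf) (h₂ : CGBLeaf) (h₃ : Thm14Leaf) : ChangGurskyYang :=
  crux_iff_fact.mpr
    (changGurskyYang_sphere_four_of_margerin_of_chernGaussBonnet_of_thm14 h₁ h₂ h₃)

/-- THEOREM 1.4 LEAF, REPAIRED: the same statement for CONNECTED closed `4`-manifolds (CGY's
standing convention). TRUE in print. [cite: ChangGurskyYang2003, Thm. 1.4] -/
def Thm14LeafConnected : Prop :=
  ∀ (M : Type) [TopologicalSpace M] [T2Space M] [SecondCountableTopology M]
    [ChartedSpace (EuclideanSpace ℝ (Fin 4)) M] [IsManifold (𝓡 4) ∞ M] [CompactSpace M]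
    [ConnectedSpace M] [MeasurableSpace M] [BorelSpace M]
    (g₀ : PseudoRiemannianMetric (𝓡 4) ∞ (EuclideanSpace ℝ (Fin 4)) (TangentSpace (𝓡 4) : M → Type _))
    [g₀.HasLeviCivita] (hg₀ : g₀.IsRiemannian),
    0 < yamabeConstant (g₀.toContMDiffRiemannianMetric hg₀) →
    1 / 4 * g₀.weylEnergy.toReal < g₀.sigma2WeylSchoutenIntegral →
    ∃ (g : PseudoRiemannianMetric (𝓡 4) ∞ (EuclideanSpace ℝ (Fin 4)) (TangentSpace (𝓡 4) : M → Type _))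
      (_ : g.HasLeviCivita) (hg : g.IsRiemannian),
      IsConformalTo (g.toContMDiffRiemannianMetric hg) (g₀.toContMDiffRiemannianMetric hg₀) ∧
      ∀ x, 1 / 4 * g.weylNormSq x < g.sigma2WeylSchouten x

/-- THEOREM 1.4 LEAF IN THE IDEATORS' SHAPE (card gv-continuity-path, `thm14_gurskyViaclovsky`,
verbatim): connected, `scal > 0` in place of `Y > 0` on the input, and `scal > 0` recorded on the
output. TRUE in print (Thm. 1.4 + Aubin: `scal > 0 ⇒ Y > 0` + p. 108 "in particular `R > 0`").
[cite: ChangGurskyYang2003, Thm. 1.4] -/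
def Thm14LeafPsc : Prop :=
  ∀ (M : Type) [TopologicalSpace M] [T2Space M] [SecondCountableTopology M]
    [ChartedSpace (EuclideanSpace ℝ (Fin 4)) M] [IsManifold (𝓡 4) ∞ M] [CompactSpace M]
    [ConnectedSpace M] [MeasurableSpace M] [BorelSpace M]
    (g₀ : PseudoRiemannianMetric (𝓡 4) ∞ (EuclideanSpace ℝ (Fin 4)) (TangentSpace (𝓡 4) : M → Type _))
    [g₀.HasLeviCivita] (hg₀ : g₀.IsRiemannian),
    (∀ x, 0 < g₀.scalarCurvature x) →
    1 / 4 * g₀.weylEnergy.toReal < g₀.sigma2WeylSchoutenIntegral →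
    ∃ (g : PseudoRiemannianMetric (𝓡 4) ∞ (EuclideanSpace ℝ (Fin 4)) (TangentSpace (𝓡 4) : M → Type _))
      (_ : g.HasLeviCivita) (hg : g.IsRiemannian),
      IsConformalTo (g.toContMDiffRiemannianMetric hg) (g₀.toContMDiffRiemannianMetric hg₀) ∧
      (∀ x, 0 < g.scalarCurvature x) ∧ ∀ x, 1 / 4 * g.weylNormSq x < g.sigma2WeylSchouten x

/-- The (false) leaf as typed implies the repaired one (more binders on `M`). [folklore] -/
theorem thm14LeafConnected_of_thm14Leaf (h : Thm14Leaf) : Thm14LeafConnected :=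
  fun M _ _ _ _ _ _ _ _ _ g₀ _ hg₀ hY hint ↦ h M g₀ hg₀ hY hint

/-- **The repaired leaf implies the ideators' shape**: `scal > 0 ⇒ Y > 0` is the tree theorem
`yamabeConstant_pos_of_scalarCurvature_pos` (Aubin 1982 §6.5), and the output metric has `R > 0`
by CGY p. 108 ("rearranging terms" gives `R ≠ 0` pointwise; `Y > 0` is conformally invariant, and a
nowhere-zero continuous `R` with positive total sign on a connected `M` is positive:
`scalarCurvature_pos_of_yamabeConstant_pos`). [cite: ChangGurskyYang2003, p. 108] -/
theorem thm14LeafPsc_of_connected (h : Thm14LeafConnected) : Thm14LeafPsc := by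
  intro M _ _ _ _ _ _ _ _ _ g₀ _ hg₀ hscal hint
  have hE : finrank ℝ (EuclideanSpace ℝ (Fin 4)) = 4 := finrank_euclideanSpace_fin
  have hY : 0 < yamabeConstant (g₀.toContMDiffRiemannianMetric hg₀) :=
    yamabeConstant_pos_of_scalarCurvature_pos g₀ hg₀ hscal
  obtain ⟨g, hLC, hg, hconf, hpt⟩ := h M g₀ hg₀ hY hint
  have hpos : ∀ (x : M) (v : TangentSpace (𝓡 4) x), v ≠ 0 → 0 < g.val x v v :=
    fun x v hv ↦ hg x v hv
  have hne : ∀ x, g.scalarCurvature x ≠ 0 := fun x ↦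
    g.scalarCurvature_ne_zero_of_sigma2WeylSchouten_gt (WithTop.coe_le_coe.mpr le_top) hE
      (hpos x) (hpt x)
  have hY' : 0 < yamabeConstant (g.toContMDiffRiemannianMetric hg) := by
    rwa [yamabeConstant_eq_of_isConformalTo hconf]
  exact ⟨g, hLC, hg, hconf, g.scalarCurvature_pos_of_yamabeConstant_pos hg hY' hne, hpt⟩

/-- **The crux from Margerin's leaf, the CGB leaf and Thm. 1.4 in the ideators' `scal > 0` shape**
(CGY 2003, §2 verbatim, with `R > 0` of the conformal metric taken from the leaf's output instead of
re-derived): the form in which a line built on card gv-continuity-path closes the crux.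
[cite: ChangGurskyYang2003, §2, p. 121] -/
theorem crux_of_leaves_psc (h₁ : MargerinLeaf) (h₂ : CGBLeaf) (h₃ : Thm14LeafPsc) :
    ChangGurskyYang := by
  rintro M _ _ _ _ _ _ _ ⟨g, _, hgR, hscal, hW⟩
  letI : MeasurableSpace M := borel M
  haveI : BorelSpace M := ⟨rfl⟩
  have hE : finrank ℝ (EuclideanSpace ℝ (Fin 4)) = 4 := finrank_euclideanSpace_fin
  -- (0.3) ⇒ (1.2) by the CGB leaf and `χ ≥ 2`
  have hWr : g.weylEnergy.toReal < 32 * Real.pi ^ 2 :=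
    (ENNReal.lt_ofReal_iff_toReal_lt (g.weylEnergy_lt_top hgR).ne).1 hW
  have h12 : 1 / 4 * g.weylEnergy.toReal < g.sigma2WeylSchoutenIntegral := by
    obtain ⟨χ, hχ, hCGBχ⟩ := h₂ M g hgR
    have hχ' : (2 : ℝ) ≤ χ := by exact_mod_cast hχ
    have hπ : 0 < Real.pi ^ 2 := by positivity
    nlinarith
  -- Thm. 1.4 (connected, psc shape): conformal `g'` with `R > 0` and `σ₂(A) - ¼|W|² > 0` pointwise
  obtain ⟨g', _, hg'R, -, hscal', hpt⟩ := h₃ M g hgR hscal h12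
  have hpos' : ∀ (x : M) (v : TangentSpace (𝓡 4) x), v ≠ 0 → 0 < g'.val x v v :=
    fun x v hv ↦ hg'R x v hv
  have hWP : ∀ x, g'.weakPinching x < 1 / 6 := fun x ↦
    g'.weakPinching_lt_of_sigma2WeylSchouten_gt (WithTop.coe_le_coe.mpr le_top) hE (hpos' x) (hpt x)
  -- Margerin: `S⁴` or `ℝP⁴`; `π₁ = 1` excludes `ℝP⁴`
  rcases h₁ M g' hg'R hscal' hWP with h | h
  · exact h
  · exact absurd ‹SimplyConnectedSpace M› (h.not_simplyConnectedSpace (by norm_num))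

/-- **The crux from the three leaves with Thm. 1.4 REPAIRED (connected `M` only)** — so the false
leaf `Thm14Leaf` is never needed: `MargerinLeaf → CGBLeaf → Thm14LeafConnected → ChangGurskyYang`.
[cite: ChangGurskyYang2003, §2, p. 121] -/
theorem crux_of_leaves_connected (h₁ : MargerinLeaf) (h₂ : CGBLeaf) (h₃ : Thm14LeafConnected) :
    ChangGurskyYang :=
  crux_of_leaves_psc h₁ h₂ (thm14LeafPsc_of_connected h₃)

/-- THE CHERN–GAUSS–BONNET LEAF IN ITS EULER-CHARACTERISTIC FORM, verbatim the hypothesis `hCGB`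
of the Euler-file reduction `changGurskyYang_sphere_four_of_chernGaussBonnet_of_margerin_of_thm14`
(ChangGurskyYangEuler.lean): (1.1) for EVERY closed smooth Riemannian `4`-manifold with
`χ(M) = relEuler ℤ ℤ M ∅`. TRUE in print (Besse 6.31; for disconnected / non-orientable closed `M`
by additivity / the orientation cover; `M = ∅` gives `0 = 0`). That reduction's `hThm14` has the
SAME missing `[ConnectedSpace M]` as the Proofs-file one, so the repair below serves both.
[cite: Besse1987, 6.31] [cite: ChangGurskyYang2003, (1.1)] -/
def CGBLeafEuler : Prop :=
  ∀ (M : Type) [TopologicalSpace M] [T2Space M] [SecondCountableTopology M]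
    [ChartedSpace (EuclideanSpace ℝ (Fin 4)) M] [IsManifold (𝓡 4) ∞ M] [CompactSpace M]
    (g : PseudoRiemannianMetric (𝓡 4) ∞ (EuclideanSpace ℝ (Fin 4)) (TangentSpace (𝓡 4) : M → Type _))
    [g.HasLeviCivita], g.IsRiemannian →
    8 * Real.pi ^ 2 * (Literature.AlgebraicTopology.SingularHomology.relEuler ℤ ℤ M ∅ : ℝ) =
      1 / 4 * g.weylEnergy.toReal + g.sigma2WeylSchoutenIntegral

/-- The Euler-form CGB leaf implies the `∃ χ ≥ 2` leaf on simply connected `M` (`χ(M) = 2 + b₂`,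
tree theorem `exists_nat_relEuler_eq_of_simplyConnectedSpace`). [cite: GompfStipsicz1999, §1.2] -/
theorem cgbLeaf_of_euler (h : CGBLeafEuler) : CGBLeaf := by
  intro M _ _ _ _ _ _ _ g _ hg
  obtain ⟨χ, hχ, hrel⟩ := exists_nat_relEuler_eq_of_simplyConnectedSpace (X := M)
  refine ⟨χ, hχ, ?_⟩
  have h' := h M g hg
  rw [hrel] at h'
  exact_mod_cast h'

/-- **The crux from the Euler-file leaves with Thm. 1.4 REPAIRED (connected `M` only)**:
`CGBLeafEuler → MargerinLeaf → Thm14LeafConnected → ChangGurskyYang` — the hypothesis order of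
`changGurskyYang_sphere_four_of_chernGaussBonnet_of_margerin_of_thm14`, with its (false as typed)
`hThm14` replaced by the connected statement. [cite: ChangGurskyYang2003, §2, p. 121] -/
theorem crux_of_eulerLeaves_connected (h₁ : CGBLeafEuler) (h₂ : MargerinLeaf)
    (h₃ : Thm14LeafConnected) : ChangGurskyYang :=
  crux_of_leaves_connected h₂ (cgbLeaf_of_euler h₁) h₃

/-- NEAR-MISS (PAPER-TRUE, not kernel-closed): **`Thm14Leaf` as typed is false.** Witness
`M = S⁴_round ⊔ (S³×S¹)_prod`: `Y > 0`, `¼∫|W|² = 0 < 16π² = ∫σ₂(A)`, but on the `S³×S¹` component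
`∫σ₂(A_g) dV_g = 0` for EVERY conformal `g` (conformal invariance of `∫σ₂`, CGY 2003 p. 110, or CGB
with `χ(S³×S¹) = 0` and `W ≡ 0`), so `σ₂(A_g) > ¼|W_g|² = 0` cannot hold pointwise. OBSTRUCTION to a
kernel proof: the tree has neither a metric on a disjoint-union manifold, nor `S³×S¹` with its
product/quotient metric, nor the conformal invariance of `∫σ₂(A) dV` (≈ the `σ₂` transformation law
+ an integration by parts) — each a sizeable development; what was tried: none of the three exists
under `lean search` (`sigma2.*conformal`, `Sum.*PseudoRiemannianMetric`, `Hopf`). The actionable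
content — the REPAIR — is kernel-checked above (`crux_of_leaves_connected`).
[cite: ChangGurskyYang2003, Thm. 1.4 and p. 110] -/
theorem thm14Leaf_false : ¬ Thm14Leaf := by
  sorry

end Leaves

/-! ## §8 Two more mutations of the scalar-curvature hypothesis (PAPER) -/

/-- The crux with `0 < scal` WEAKENED to `0 ≤ scal`. PAPER-TRUE (so the strictness of `R > 0` is
NOT load-bearing, only the sign class is): if `R ≡ 0` then CGB gives
`∫|W|² = 32π²χ + 2∫|E|² ≥ 64π²` on a closed simply connected `M` (`χ ≥ 2`), contradicting
`∫|W|² < 32π²`; if `R ≥ 0`, `R ≢ 0`, the conformal class is Yamabe-positive (Trudinger/Kazdan–Warner)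
and `∫|W|²` is conformally invariant, so CGY Thm. A applies. [cite: ChangGurskyYang2003, Thm. A and (0.4)] -/
def ChangGurskyYangScalarNonneg : Prop :=
  ∀ (M : Type) [TopologicalSpace M] [T2Space M] [SecondCountableTopology M]
    [ChartedSpace (EuclideanSpace ℝ (Fin 4)) M] [IsManifold (𝓡 4) ∞ M] [CompactSpace M]
    [SimplyConnectedSpace M],
    (∃ g : PseudoRiemannianMetric (𝓡 4) ∞ (EuclideanSpace ℝ (Fin 4)) (TangentSpace (𝓡 4) : M → Type _),
      ∃ _ : g.HasLeviCivita, g.IsRiemannian ∧ (∀ x, 0 ≤ g.scalarCurvature x) ∧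
        g.weylEnergy < ENNReal.ofReal (32 * Real.pi ^ 2)) →
    Nonempty (M ≃ₘ⟮𝓡 4, 𝓡 4⟯ S⁴)

/-- The `scal ≥ 0` form implies the crux (fewer hypotheses used). [folklore] -/
theorem crux_of_scalarNonneg (h : ChangGurskyYangScalarNonneg) : ChangGurskyYang :=
  fun M _ _ _ _ _ _ _ ⟨g, hLC, hg, hR, hW⟩ ↦ h M ⟨g, hLC, hg, fun x ↦ (hR x).le, hW⟩

/-- The crux with `< 32π²` WEAKENED to `≤ 32π²`. PAPER-TRUE (CGY Thm. A + Thm. B: at equality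
`∫|W|² = 32π² = 16π²χ` forces `b₂ = 0`, and the equality cases `ℂP²` (`b₂ = 1`) and quotients of
`S³×ℝ` (`π₁ ≠ 1`) are excluded on a simply connected `M`; for `b₂ ≥ 1`, `32π² < 16π²χ` and Thm. A
applies directly). So the strict `<` of the energy bound is not load-bearing either.
[cite: ChangGurskyYang2003, Thm. B] -/
def ChangGurskyYangEnergyLe : Prop :=
  ∀ (M : Type) [TopologicalSpace M] [T2Space M] [SecondCountableTopology M]
    [ChartedSpace (EuclideanSpace ℝ (Fin 4)) M] [IsManifold (𝓡 4) ∞ M] [CompactSpace M]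
    [SimplyConnectedSpace M],
    (∃ g : PseudoRiemannianMetric (𝓡 4) ∞ (EuclideanSpace ℝ (Fin 4)) (TangentSpace (𝓡 4) : M → Type _),
      ∃ _ : g.HasLeviCivita, g.IsRiemannian ∧ (∀ x, 0 < g.scalarCurvature x) ∧
        g.weylEnergy ≤ ENNReal.ofReal (32 * Real.pi ^ 2)) →
    Nonempty (M ≃ₘ⟮𝓡 4, 𝓡 4⟯ S⁴)

/-- The `≤` form implies the crux. [folklore] -/
theorem crux_of_energyLe (h : ChangGurskyYangEnergyLe) : ChangGurskyYang :=
  fun M _ _ _ _ _ _ _ ⟨g, hLC, hg, hR, hW⟩ ↦ h M ⟨g, hLC, hg, hR, hW.le⟩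

/-! ## §9 Targets (pre-emptive, gen 2): the ideators' published FIRST LEMMAS as typed

No line is picked yet (`payload.targets = []`), but the round-1 cards have published their first
lemmas in this directory (`IdeasSketchR1K1.lean`, `IdeasSketchR1K2.lean`, `SketchIdeator3.lean`).
The standing adversary attacked the one algebraic lemma shared by the three Margerin-cone cards:

* `Sketch3.MargerinPolynomialNonpos` / `Sketch3.MargerinPolynomialNeg` (card margerin-certified-cone,
  `SketchIdeator3.lean`): **FALSE AS TYPED, kernel-checked below** (`margerinPolynomialNonpos_false`,
  `margerinPolynomialNeg_false`, on VERBATIM copies of the definitions — copies, not an import, so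
  that a later repair of the sketch cannot break this file). The lemma quantifies over ALL block
  triples `(A, B, C) ∈ (ℝ^{3×3})³` with `tr A + tr C > 0`, `wpNum ≤ (1/6)(tr A + tr C)²`; but
  Margerin's inequality is a statement about ALGEBRAIC CURVATURE OPERATORS, i.e. `A`, `C`
  SYMMETRIC (and `tr A = tr C`, Bianchi). Integer witness: `A = !![2,0,1; 1,1,-1; -1,1,1]`
  (not symmetric), `B = 0`, `C = 1`: `scalB = 7 > 0`, `wpNum = 17/3 < 49/6 = (1/6)·7²`,
  `field = (!![7,1,7; 6,6,-5; -4,8,3], 0, 3·1)`, `dWpNum = 190/3`, `scalB (field) = 25`, and the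
  "fundamental polynomial" `D = (190/3)·49 - (17/3)·(2·7·25) = 1120 > 0`. Found by the adversarial
  search `kit/p3_search.py` (mode `full`: every restart climbs to `D ≈ +0.16` at `scalB = 1`; mode
  `trace` — equal traces, non-symmetric — also fails, `D ≈ +0.125`; mode `sym` — symmetric,
  traces free — and mode `symtrace` found max `D = 0` only: SYMMETRY is the load-bearing omission).
  Consequence: no Positivstellensatz certificate for the lemma as typed can exist; and since `D > 0`
  at a point with `WP = 17/147 < 1/6`, the sublevel set `{WP ≤ 17/147}` of ALL blocks is exited by
  the ODE trajectory through the witness, so `Sketch3.MargerinConeInvariant` (all `0 < c ≤ 1/6`) is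
  PAPER-false as typed too (a kernel proof would need a local ODE solution). REPAIR (stub-misstated):
  intersect with the curvature-operator subspace `{A = Aᵀ, C = Cᵀ, tr A = tr C}` (convex, closed,
  `field`-invariant, reflection-symmetric) — then the statement is ideator 2's `margerinP2_nonpos`.
* `Sketch.margerinP2_nonpos` (cards margerin-block-polynomial / margerin-cone-hamilton-rails,
  `IdeasSketchR1K2/K1.lean`: `A`, `C` symmetric, `tr A = tr C ≥ 0`, `‖Å‖²+2‖B‖²+‖C̊‖² ≤ (2/3)(tr A)²`):
  NOT broken — independent adversarial search `kit/p2_search.py` (Lean definitions transcribed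
  verbatim, projected hill-climbing + exact rational re-check inside the closed cone): local smoke
  run max `P₂ = 0` attained only on the rigid rays (`S³×ℝ`: `(I, I, I)/3` and its `SO(3)`-orbit
  `B ∈ ⅓SO(3)`; `ℂP²`: `B = 0`, `Å ∝ diag(-1,-1,2)`), control `k = 7/10 > 2/3` DOES find `P₂ > 0`
  (`≈ 0.0173`, the `ℂP²` direction, exact) — so the method bites where it should; full runs: kit
  j010242 (`k = 2/3`, 500 restarts), j010243 (`k = 7/10` control), j010244 (`k = 3/5` control),
  results attach to the item as evidence. By hand (`T = tr A = 1`):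
  `P₂ = 9(det Å + det C̊) + 12 det B + 3tr(Å BBᵀ) + 3tr(C̊ BᵀB) - ‖Å‖² - ‖C̊‖² - (2/3)‖B‖² - ‖B‖²·m`,
  `m = ‖Å‖² + 2‖B‖² + ‖C̊‖² ≤ 2/3`; the decoupled term-wise upper bound is POSITIVE (`≈ 0.196` at
  `a = c = 0.3`), so only the coupling between `det B` (wants `B ∝ SO(3)`) and `tr(Å BBᵀ)` (wants
  `B` of rank one) saves the inequality — a certificate must see that coupling (no term-by-term SOS).
* `Sketch3.WeylShiftedGV` = `Thm14LeafPsc` of §7 verbatim (so `crux_of_leaves_psc` is its glue);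
  `Sketch3.ShiftedPathStart`, `Sketch3.RoundLimit`, `Sketch.thm14_gurskyViaclovsky`
  (= `Thm14LeafPsc`), `Sketch.weakPinching_ge_on_neck`: true in print, nothing cheap bites.
-/

namespace Sketch3AsTyped

/-- VERBATIM `Sketch3.frob` (SketchIdeator3.lean, tree commit 10dfdee6). -/
def frob (M : Matrix (Fin 3) (Fin 3) ℝ) : ℝ := ∑ i, ∑ j, (M i j) ^ 2

/-- VERBATIM `Sketch3.frobInner`. -/
def frobInner (M N : Matrix (Fin 3) (Fin 3) ℝ) : ℝ := ∑ i, ∑ j, M i j * N i j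

/-- VERBATIM `Sketch3.tf` (trace-free part). -/
def tf (M : Matrix (Fin 3) (Fin 3) ℝ) : Matrix (Fin 3) (Fin 3) ℝ :=
  M - (M.trace / 3) • (1 : Matrix (Fin 3) (Fin 3) ℝ)

/-- VERBATIM `Sketch3.wpNum` (`|W|² + 2|E|²` in blocks). -/
def wpNum (p : HamiltonODE.Blocks) : ℝ := frob (tf p.1) + frob (tf p.2.2) + 2 * frob p.2.1

/-- VERBATIM `Sketch3.scalB` (`R ∝ tr A + tr C`). -/
def scalB (p : HamiltonODE.Blocks) : ℝ := p.1.trace + p.2.2.trace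

/-- VERBATIM `Sketch3.dWpNum`. -/
def dWpNum (p q : HamiltonODE.Blocks) : ℝ :=
  2 * frobInner (tf p.1) (tf q.1) + 2 * frobInner (tf p.2.2) (tf q.2.2) + 4 * frobInner p.2.1 q.2.1

/-- VERBATIM `Sketch3.MargerinPolynomialNonpos` — card margerin-certified-cone's FIRST LEMMA (A),
"the certificate target". [cite: Margerin1998, Prop. 4] -/
def MargerinPolynomialNonpos : Prop :=
  ∀ p : HamiltonODE.Blocks, 0 < scalB p → wpNum p ≤ (1 / 6 : ℝ) * scalB p ^ 2 →
    dWpNum p (HamiltonODE.field p) * scalB p ^ 2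
      - wpNum p * (2 * scalB p * scalB (HamiltonODE.field p)) ≤ 0

/-- VERBATIM `Sketch3.MargerinPolynomialNeg` (the strict form). [cite: Margerin1998, Lemma 9] -/
def MargerinPolynomialNeg : Prop :=
  ∀ p : HamiltonODE.Blocks, 0 < scalB p → 0 < wpNum p → wpNum p < (1 / 6 : ℝ) * scalB p ^ 2 →
    dWpNum p (HamiltonODE.field p) * scalB p ^ 2
      - wpNum p * (2 * scalB p * scalB (HamiltonODE.field p)) < 0

/-- The witness `A = !![2,0,1; 1,1,-1; -1,1,1]` — NOT symmetric (no algebraic curvature operator has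
such an `A`-block). [folklore] -/
def witA : Matrix (Fin 3) (Fin 3) ℝ := !![2, 0, 1; 1, 1, -1; -1, 1, 1]

/-- The witness block triple `(A, 0, 1)`. [folklore] -/
def witP : HamiltonODE.Blocks := (witA, 0, 1)

/-- `A^# = !![2,0,2; 1,3,-2; -1,3,2]` (cofactor matrix). [folklore] -/
theorem sharp_witA : witA.sharp = !![2, 0, 2; 1, 3, -2; -1, 3, 2] := by
  ext i j
  fin_cases i <;> fin_cases j <;>
    simp [Matrix.sharp, Matrix.adjugate_fin_three, witA] <;> norm_num

/-- `1^# = 1`. [folklore] -/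
theorem sharp_one3 : (1 : Matrix (Fin 3) (Fin 3) ℝ).sharp = 1 := by
  simp [Matrix.sharp]

/-- `0^# = 0`. [folklore] -/
theorem sharp_zero3 : (0 : Matrix (Fin 3) (Fin 3) ℝ).sharp = 0 := by
  simp [Matrix.sharp, Matrix.adjugate_zero]

/-- **Hamilton's ODE at the witness**: `field (A, 0, 1) = (A² + 2A^#, 0, 1 + 2·1) =
(!![7,1,7; 6,6,-5; -4,8,3], 0, 3)`. [cite: Hamilton1986, §6, p. 166] -/
theorem field_witP : HamiltonODE.field witP =
    (!![7, 1, 7; 6, 6, -5; -4, 8, 3], 0, !![3, 0, 0; 0, 3, 0; 0, 0, 3]) := by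
  simp only [HamiltonODE.field, witP]
  refine Prod.ext ?_ (Prod.ext ?_ ?_)
  · rw [sharp_witA]
    ext i j
    fin_cases i <;> fin_cases j <;> simp [witA] <;> norm_num
  · simp [sharp_zero3]
  · rw [sharp_one3]
    ext i j
    fin_cases i <;> fin_cases j <;> simp <;> norm_num

/-- `scalB = tr A + tr C = 4 + 3 = 7`. [folklore] -/
theorem scalB_witP : scalB witP = 7 := by
  simp [scalB, witP, witA, Matrix.trace, Fin.sum_univ_three]
  norm_num

/-- `scalB (field) = 16 + 9 = 25 (= (tr A)² + (tr C)²)`. [folklore] -/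
theorem scalB_field_witP : scalB (HamiltonODE.field witP) = 25 := by
  rw [field_witP]
  simp [scalB, Matrix.trace, Fin.sum_univ_three]
  norm_num

/-- `wpNum = ‖tf A‖² = 17/3` (`tf C = 0`, `B = 0`), and `17/3 < 49/6`: the witness is weakly
`1/6`-pinched in the lemma's sense (`WP = 17/147 ≈ 0.116 < 1/6`). [folklore] -/
theorem wpNum_witP : wpNum witP = 17 / 3 := by
  simp [wpNum, frob, tf, witP, witA, Matrix.trace, Fin.sum_univ_three, Matrix.sub_apply,
    Matrix.smul_apply, Matrix.one_apply]
  norm_num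

/-- `dWpNum = 2⟨tf A, tf A'⟩ = 190/3`. [folklore] -/
theorem dWpNum_witP : dWpNum witP (HamiltonODE.field witP) = 190 / 3 := by
  rw [field_witP]
  simp [dWpNum, frobInner, tf, witP, witA, Matrix.trace, Fin.sum_univ_three, Matrix.sub_apply,
    Matrix.smul_apply, Matrix.one_apply]
  norm_num

/-- **Margerin's fundamental polynomial at the witness is POSITIVE**:
`D = (190/3)·7² - (17/3)·(2·7·25) = 1120`. [folklore] -/
theorem D_witP : dWpNum witP (HamiltonODE.field witP) * scalB witP ^ 2
    - wpNum witP * (2 * scalB witP * scalB (HamiltonODE.field witP)) = 1120 := by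
  rw [dWpNum_witP, scalB_witP, wpNum_witP, scalB_field_witP]
  norm_num

/-- **STUB-FALSE: `Sketch3.MargerinPolynomialNonpos` as typed** (over all block triples, symmetry
of `A`, `C` omitted) — refuted by `(A, 0, 1)`, `A = !![2,0,1; 1,1,-1; -1,1,1]`. Repair: restrict to
`A = Aᵀ`, `C = Cᵀ`, `tr A = tr C`. [folklore] -/
theorem margerinPolynomialNonpos_false : ¬ MargerinPolynomialNonpos := by
  intro h
  have h1 : (0 : ℝ) < scalB witP := by rw [scalB_witP]; norm_num
  have h2 : wpNum witP ≤ (1 / 6 : ℝ) * scalB witP ^ 2 := by rw [wpNum_witP, scalB_witP]; norm_num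
  have h3 := h witP h1 h2
  rw [D_witP] at h3
  norm_num at h3

/-- **STUB-FALSE: `Sketch3.MargerinPolynomialNeg` as typed** — same witness
(`0 < 17/3 < 49/6`, `D = 1120 ≮ 0`). [folklore] -/
theorem margerinPolynomialNeg_false : ¬ MargerinPolynomialNeg := by
  intro h
  have h1 : (0 : ℝ) < scalB witP := by rw [scalB_witP]; norm_num
  have h2 : (0 : ℝ) < wpNum witP := by rw [wpNum_witP]; norm_num
  have h3 : wpNum witP < (1 / 6 : ℝ) * scalB witP ^ 2 := by rw [wpNum_witP, scalB_witP]; norm_num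
  have h4 := h witP h1 h2 h3
  rw [D_witP] at h4
  norm_num at h4

end Sketch3AsTyped

-- Targets (lead's stuck stubs): none registered yet (`payload.targets = []`, 2026-08-16, gen 2);
-- the pre-emptive leaf audit of §7 stands in for them.

end Summit.SmoothPoincare4.SmoothPoincare4.Cruxes.ChangGurskyYang.Disproof

end
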